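import Literature.MathematicalPhysics.QuantumFieldTheory.Balaban1983to89.Node00.N24ItemsStage13AtThm1CCMWOfStepRSignFreeAllTorusSepCoPH
import Summits.QuantumFields.YangMills.Theorems.BalabanUVNodesK0ROfStepTokensRCube

/-!
# NODE N24 AT THE V17 K0⁷ WITNESS WITH THE K0 SIDE OPENED TO EXACTLY plan g77's announced V17 STUB BODIES (`N = 2`, `j = 3`) — THE SIGN-FREE EDITION OF PART 10: K1⁷'s θ-KEYED CONSEQUENT
# AND THE REGISTERED RUNG BODIES AT THE HISTORY-BLIND DOOR OVER THE CURED RESIDUAL OF THE WINDOWED CUBE WITNESS `θ₁₅ᶜᶜᴹᵂ(3; γ; ε₀, ε₂₉; B₃, B₃', a₀, a₁')`, the door provisos `hP`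
# DISCHARGED BY NAME modulo [15] Prop. 8's top step (stub 1 opened), [6] Prop. 6 at NODE 00's member (stub 2 opened), the window `0 < γ ≤ ½`, the thresholds and the SIGN-FREE windowed
# β-box on `]0, γ]` of the β of record of V15's witness `θ₁₅ᶜᶜᴹ(3; …)` with the letters `−bₗ·γ² ≤ 3`, `β'·γ² ≤ ¾` (stub 3ᴬ's ∃-output after dag-n21-c FILE Cʷ′'s window-shrinking
# `windowLettersBox_of_absBetaBox`; NO `0 ≤ b`, NO sign of β) and — for any gauge constant `B₃' ≥ b9Of F L³ B₁ · B₃` and ceiling `0 < a₁' ≤ min a₁ (a0Of F 2 L³ B₁ c₁ ∕ B₃)`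

ALL-TORUS EDITION (gen 8; dag-n21-c g13 (a) p575996 `Record13SepCoPInhabitedOfThm1CCMWGaugeRAllTorus`: B′'s global `hsN` ⟸ `PartCompat₁₃` on EVERY family, so Eʷ's
★★★ʷʰ holds WITHOUT `hjm : j + 1 ≤ F.m` — `bgSepCoPAt_theta13OfThm1CCMW_of_thm1GaugeR_of_hcomp_allTorus`; (b) p576368 Cʷ″ `record13SepCoPHBody_of_stubs123A`: V17's stub 4 ((δ), `F.m ≤ 3`)
is DERIVABLE from stubs 1∕2∕3ᴬ).  THIS FILE = the previous edition of the same name (without `AllTorus`) with the torus-size binder (`hjm` ∕ `hm : 4 ≤ F.m`) DELETED from every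
statement and proof and the engine re-pointed to (a)'s `_allTorus` ★★★ʷʰ; nothing else changes; so N24's K1⁷ door at the V17 witness now serves EVERY family `F`.

TRACK A (YM-PLAN §2d, node N24 of 28 = binder B2 `hB : B16.EndStatementBPrinted D.C`), seat `pub-ymgap-dag-n24-c` (R134 fan-out seat, strategy s2; gen 8, Part 15 (all-torus edition of Part 12)).  Key of record: K1⁷
`StabilityBAtRecordR13SepCoPH` = stmt-QuantumFields-20542; this file `--supports` it as a helper (Summits lane: it imports dag-n21-c's FILE C `BalabanUVNodesK0ROfStepTokensRCube` and,
through it, dag-n07-e's bridge `BalabanUVNodesN07Thm1Top7FromProp8`).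
WHY (plan g77 SIGNFREE-WORD INBOX l.22622: «V17 = 3ᴬ» = «∀ guarded `(B₃, B₃', a₀, a₁)` carrying (8) and the R (9)-step at `(L³, (44+3L)L)`, ∃ γ₀ ε₀ ε₂₉ β′, 0 < γ₀ ∧ 0 < ε₀ ∧ 0 < ε₂₉ ∧
`BetaLowerH (−β′) γ₀` ∧ `BetaUpperH β′ γ₀` of `betaOfRecord₁₃ F 2 θ₁₅ᶜᶜᴹ(3; …)`» — [I] §1 p.264 ∕ Thm 2 «uniformly bounded», NO sign; node O P3 g48 EVIDENCE-N78 l.22609; dag-n21-c g12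
FILES Dʷ∕Eʷ ✓, Cʷ′ announced l.22742): Part 10's §0 reads `0 ≤ b` (A2ʷ `hmono_…_of_betaLowerH_half`) — the SIGN — so it cannot serve a closer working from 3ᴬ.  On the sign-free road the
closer shrinks 3ᴬ's window ONCE by Cʷ′'s `windowLettersBox_of_absBetaBox` (node O's `exists_window_letters_signFree`: `γ := min γ₀ (min ½ (1+β′)⁻¹)`, `bₗ := −β′`) to letters
`(γ, ε₀, ε₂₉, bₗ, β′)` with `0 < γ ≤ ½`, `−bₗ·γ² ≤ 3`, `β′·γ² ≤ ¾` and the two-sided box on `]0, γ]` — EXACTLY §0's displayed K0-box hypotheses here (letters ATOMIC; Part 10's TYPING NOTE: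
compound window letters inside `theta13OfThm1CCMW F 2 3 γ …` put the `pinX3HS` statements over the `whnf` cliff).  §0 keeps the V15∕V16∕V17 chain POINTED: Prop. 8 ⇒ (8) at the shrunk
ceiling by dag-n07-e's `variationalThm1RegSepCoP7M_of_prop8TopStep` (`Prop8RegSepTopStep.of_le`), Prop. 8 ∧ Prop. 6 ⇒ the window-blind R (9)-step at `(L³, (11·4+3L)·L; B₃, b9Of·B₃, a₀,
min a₁ (a0Of∕B₃))` by FILE C's `gauge9R_cube_of_prop8TopStep_of_prop6Member` ⇒ the (9)-line-1 sentence by B′, weakened to `(B₃', a₁')` by `.mono ∕ .of_le`; collar by A2ʷ's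
`collar_le_M₁_theta13OfThm1CCMW`; the two comparability clauses at `θ₁₅ᶜᶜᴹᵂ(3; γ)` from the SIGN-FREE box on θ₁₅ᶜᶜᴹ(3)'s β by FILE Dʷ's `hcompBoth_theta13OfThm1CCMW_of_betaBoxSignFree_half`;
then Part 11's pointed §0a `N24_provisos₁₃SepCoPH_door_theta13OfThm1CCMW_of_thm1GaugeR_of_hcomp_allTorus` at `j := 3`, no `hjm` (= FILE Eʷ ★★★ʷʰ through the two doors).  §2 = Part 8 §2's five
door forms at `N := 2`, `j := 3` with `hP := §0` — Part 10's §2 with `hb : 0 ≤ b` REPLACED by `hl : −bₗ·γ² ≤ 3`, nothing else changed.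
So «WHICH CHILD BLOCKS K1⁷ AT THE V17 WITNESS», kernel form (§2 rung-1 hypothesis list): K0 side = V17's three stubs' BODIES (stub 1 [15] Prop. 8's top step; stub 2 [6] Prop. 6 at the member;
stub 3ᴬ's output letters after one window-shrinking); then the world S-bound to the H-pinned (or X-rebound) four-pin view (letters free; `w.γ ≤ γ`); N05 ∕ N06 ∕ N07 ∕ N08 ∕
N09 (+ `h09T`) ∕ N10 ∕ N11 (S1ᵀ) ∕ N12 leaves; N13's (UV₁₃); and (consequent ∕ rung 2) the WORLD's β-box letters `hlo ∕ hhi` on the window edition's β on `]0, w.γ]`, `w.γ ≤ γ`: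
the UPPER one is the K0 box's `hbox'` at `w.βup = β'` (through dag-n21-c `betaUpperH_theta13OfThm1CCMW_of_half`); the LOWER one reads `0 < w.b` (`WorldP.b_pos`, `leavesP.betaPositive`)
— NODE O's positive lower bound on β ([I] (0.33) ∕ (1.22); the one-loop sign, unprinted in [B5]–[B16]) — and is NOT supplied by the sign-free K0 box (`bₗ` may be ≤ 0): V17 relieves
K0⁷'s stub 3 of the sign, NOT K1⁷'s rung 2 ∕ consequent (`endStatementBPrinted_of_nodesP_interval` reads `BetaBoundsInInterval … w.b w.βup`).
A NEW importing module (imports Part 11 + FILE C; NOT Cʷ′).  THEOREMS ONLY, def-free, sorry-free, standard axioms; every §2 proof is ONE application of the Part 8 door theorem at `N := 2`.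

WHAT THIS FILE PROVES (6 theorems).  §0 `N24_provisos₁₃SepCoPH_door_theta13OfThm1CCMW_cube_of_prop8TopStep_of_prop6Member_of_betaBoxSignFree_allTorus`.  §2 `N24_stabilityBR13SepCoPH_thetaShape20_rebindX_fourPin_pointed_theta13OfThm1CCMW_cube_of_prop8TopStep_of_prop6Member_of_betaBoxSignFree_allTorus_door`,
`N24_betaWindowAtSomeRecord₁₃SepCoPH_of_rebindX_fourPin_pointed_of_boxH_theta13OfThm1CCMW_cube_of_prop8TopStep_of_prop6Member_of_betaBoxSignFree_allTorus_door`, `N24_stabilityBR13SepCoPH_thetaShape20_pinX3HS_fourPin_pointed_theta13OfThm1CCMW_cube_of_prop8TopStep_of_prop6Member_of_betaBoxSignFree_allTorus_door`,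
`N24_nodesAtSomeRecordS₁₃SepCoPH_of_pinX3HS_fourPin_pointed_theta13OfThm1CCMW_cube_of_prop8TopStep_of_prop6Member_of_betaBoxSignFree_allTorus_door` (rung 1; at `N = 2` its conclusion is the registered v5 text `NodesAtSomeRecord13PWS F`'s body),
`N24_betaWindowAtSomeRecordS₁₃SepCoPH_of_pinX3HS_fourPin_pointed_of_boxH_theta13OfThm1CCMW_cube_of_prop8TopStep_of_prop6Member_of_betaBoxSignFree_allTorus_door` (rung 2; `BetaWindowAtSomeRecord13S F`'s body).

HONEST FRAMING: composition BY NAME; nothing of Bałaban's asserted — [15] Prop. 8's top step, [6] Prop. 6 at the member, the window, the sign-free windowed β-box with its two letters, every child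
leaf are DISPLAYED hypotheses; 3ᴬ is [I] Thm 2's «uniformly bounded» (stated in print, proof unpublished) and is NOT proved here; K0⁷ ∕ K1⁷ NOT closed; N24 COMPOSITE — no
discharge, no count moved (5∕27), no stub closed; one finite T⁴ programme at fixed ε; NOT continuum ∕ ℝ⁴ ∕ OS ∕ mass gap ∕ Clay.
-/

noncomputable section

open scoped Matrix.Norms.L2Operator

namespace Summit.QuantumFields.YangMills.BalabanUVNodes.N24AtThm1CCMWDoorOfStepTokensSignFreeAllTorus

open Literature.MathematicalPhysics.QuantumFieldTheory.Balaban1983to89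
open Literature.MathematicalPhysics.QuantumFieldTheory.Balaban1983to89.Node00
open DagBinding T4Continuum T4DatumAssembly FlowStepRuns AveragingRT
open FlowStep (BetaLowerH BetaUpperH)
open Summit.QuantumFields.YangMills.BalabanUVNodes.N07Thm1Top7FromProp8 (variationalThm1RegSepCoP7M_of_prop8TopStep)
open Summit.QuantumFields.YangMills.Theorems.K0ROfStepTokensRCube (gauge9R_cube_of_prop8TopStep_of_prop6Member)

variable {F : T4Family}

/-! ## §0. The door provisos at the windowed cube witness POINTED, from V17's stub bodies (FILE C's window-blind (9)-step + dag-n07-e's bridge + FILE Dʷ's sign-free comparability + Part 11 §0a) -/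

/-- **★★ THE v1.7 DOOR PROVISOS AT THE WINDOWED CUBE WITNESS `θ₁₅ᶜᶜᴹᵂ(3; γ; ε₀, ε₂₉; B₃, B₃', a₀, a₁')`, `N = 2`, (EVERY family `F` — no `4 ≤ F.m`), POINTED, FROM EXACTLY V17's STUB BODIES — NO SIGN OF β**:
[15] Prop. 8's top step at `(B₃, a₀, a₁)` with the floor `2L² ≤ B₃` and `0 < a₀` (stub 1; its `0 < a₁` is not needed once the ceiling is shrunk to `a₁' ≤ a₁`), [6] Prop. 6 at NODE 00's
member `(B₁, c₁)` (stub 2), the window `0 < γ ≤ ½`, thresholds `0 < ε₀`, `0 < ε₂₉` and the SIGN-FREE windowed β-box `(bₗ, β')` on `]0, γ]` of the β of record of V15's witness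
`betaOfRecord₁₃ F 2 (theta13OfThm1CCM F 2 3 ε₀ ε₂₉ B₃ B₃' a₀ a₁')` with the two letters `−bₗ·γ² ≤ 3`, `β'·γ² ≤ ¾` (stub 3ᴬ's ∃-output after ONE window-shrinking, dag-n21-c FILE Cʷ′
`windowLettersBox_of_absBetaBox`: `γ := min γ₀ (min ½ (1+β′)⁻¹)`, `bₗ := −β′`) — for ANY gauge constant `B₃' ≥ b9Of F L³ B₁ · B₃` and ANY ceiling
`0 < a₁' ≤ min a₁ (a0Of F 2 L³ B₁ c₁ ∕ B₃)` (V15∕V16∕V17's exact letters with `le_rfl`; letters ATOMIC in the statement).  The chain kept POINTED: Prop. 8 ⇒ (8) at `a₁'` by dag-n07-e's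
bridge (`Prop8RegSepTopStep.of_le`), Prop. 8 ∧ Prop. 6 ⇒ the window-blind R (9)-step at the cube letters by FILE C's `gauge9R_cube_of_prop8TopStep_of_prop6Member` ⇒ the (9)-line-1 sentence by
B′ `variationalThm1GaugeRegSepCoP7MR_of_gauge9TopStepR`, weakened to `(B₃', a₁')` by B′'s `.mono ∕ .of_le`; collar `(11·4+3L)·L ≤ L³ = ν.M₁` by A2ʷ's `collar_le_M₁_theta13OfThm1CCMW`; the two
comparability clauses (hcomp) ∧ (hcompRev) at `θ₁₅ᶜᶜᴹᵂ` from the sign-free box on `θ₁₅ᶜᶜᴹ`'s β by FILE Dʷ's `hcompBoth_theta13OfThm1CCMW_of_betaBoxSignFree_half` (node O P3 g48's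
arithmetic); then Part 11's pointed §0a `N24_provisos₁₃SepCoPH_door_theta13OfThm1CCMW_of_thm1GaugeR_of_hcomp_allTorus` at `j := 3`, no `hjm` (FILE Eʷ ★★★ʷʰ through the two doors).  = Part 10's
`…_of_betaBoxW` with `hb : 0 ≤ b` REPLACED by `hl : −bₗ·γ² ≤ 3`.  CONDITIONAL on every displayed hypothesis; nothing of Bałaban asserted; K0⁷ NOT closed here.
[cite: Balaban1985Variational, Thm 1 (8)–(9) p.279, (144)–(152) pp.300–301, Prop. 8 p.304; Balaban1985RegularSpaces, (1.3)–(1.9) p.77, Prop. 6 p.99; Balaban1988Convergent, Thm 1 p.262, (2.4)–(2.8) pp.255–256, (2.12)–(2.13) p.256, (2.21) p.258, (3.16)–(3.23) pp.268–270; Balaban1987RG1, (0.1) p.251, Thm 1 p.255, (0.20) p.256, (1.11)–(1.12) p.262, (1.20)–(1.22) p.264, §1 p.264; Balaban1989LargeFieldI, (0.2)–(0.4) p.176; Balaban1989LargeFieldII, (1.4) p.357] -/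
theorem N24_provisos₁₃SepCoPH_door_theta13OfThm1CCMW_cube_of_prop8TopStep_of_prop6Member_of_betaBoxSignFree_allTorus (F : T4Family) {B₃ a₀ a₁ B₁ c₁ B₃' a₁' : ℝ}
    (hB₃ : 2 * (F.L : ℝ) ^ 2 ≤ B₃) (ha₀ : 0 < a₀)
    (h8 : Prop8RegSepTopStep F 2 (fun ν K Ω => suppDomOfRecord F ν K Ω) B₃ a₀ a₁) (hB₁ : 0 ≤ B₁) (hc₁ : 0 < c₁)
    (hP6 : letI : CStarAlgebra (MatA 2) := {}; B8.Prop6Printed 4 (F.L : ℝ) B₁ c₁ (fun i : B8LeafModelZd.ZdIdx 4 F.L => zdCub (MatA 2) F.L i))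
    (hB₉ : b9Of F (F.L ^ 3) B₁ * B₃ ≤ B₃') (ha₁' : 0 < a₁') (ha₁'le : a₁' ≤ min a₁ (a0Of F 2 (F.L ^ 3) B₁ c₁ / B₃))
    {γ ε₀ ε₂₉ bl β' : ℝ} (hγ₀ : 0 < γ) (hγh : γ ≤ 1 / 2) (hε : 0 < ε₀) (hε' : 0 < ε₂₉)
    (hbox : BetaLowerH bl γ (betaOfRecord₁₃ F 2 (theta13OfThm1CCM F 2 3 ε₀ ε₂₉ B₃ B₃' a₀ a₁')))
    (hbox' : BetaUpperH β' γ (betaOfRecord₁₃ F 2 (theta13OfThm1CCM F 2 3 ε₀ ε₂₉ B₃ B₃' a₀ a₁'))) (hl : -bl * γ ^ 2 ≤ 3) (hβ' : β' * γ ^ 2 ≤ 3 / 4) :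
    (Stage13HParams.ofHistoryBlind F 2 ⟨theta13OfThm1CCMW F 2 3 γ ε₀ ε₂₉ B₃ B₃' a₀ a₁', ZrOfRecord₁₃ F 2 (theta13OfThm1CCMW F 2 3 γ ε₀ ε₂₉ B₃ B₃' a₀ a₁')⟩).Provisos₁₃SepCoPH F 2 := by
  have hL0 : (0 : ℝ) < (F.L : ℝ) := by exact_mod_cast lt_trans Nat.zero_lt_one F.hL.2
  have hBpos : (0 : ℝ) < B₃ := lt_of_lt_of_le (mul_pos two_pos (pow_pos hL0 2)) hB₃
  have hB9 : (0 : ℝ) ≤ B₃' := (mul_nonneg (b9Of_pos (F := F) (F.L ^ 3) hB₁).le hBpos.le).trans hB₉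
  have H := hcompBoth_theta13OfThm1CCMW_of_betaBoxSignFree_half (F := F) (N := 2) (j := 3) (ε₀ := ε₀) (ε₂₉ := ε₂₉) (B₃ := B₃) (B₃' := B₃') (a₀ := a₀) (a₁ := a₁')
    hγh hBpos.le hB9 ha₀.le ha₁'.le hbox hbox' hl hβ'
  exact N24_provisos₁₃SepCoPH_door_theta13OfThm1CCMW_of_thm1GaugeR_of_hcomp_allTorus (N := 2) (j := 3) hγ₀ hγh hε hε' hBpos.le hB9 ha₀ ha₁'
    (variationalThm1RegSepCoP7M_of_prop8TopStep hBpos (h8.of_le le_rfl (ha₁'le.trans (min_le_left _ _))))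
    ((theta13OfThm1CCMW_M₁ F 2 3 γ ε₀ ε₂₉ B₃ B₃' a₀ a₁') ▸ collar_le_M₁_theta13OfThm1CCMW F 2 γ ε₀ ε₂₉ B₃ B₃' a₀ a₁' (le_refl 3))
    (((variationalThm1GaugeRegSepCoP7MR_of_gauge9TopStepR (gauge9R_cube_of_prop8TopStep_of_prop6Member F hBpos h8 hB₁ hc₁ hP6)).mono hB₉).of_le le_rfl ha₁'le)
    H.1 H.2


/-! ## §2. `N = 2`, `j = 3`, the cube letters kept atomic: `hP` ⟸ EXACTLY V17's stub bodies (Prop. 8 top step, Prop. 6 at the member, window + thresholds + SIGN-FREE windowed β-box with letters) -/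

/-- **AT THE V17 WITNESS (EVERY family `F` — no `4 ≤ F.m`), `N = 2`, `j = 3`, WITH `hP` DISCHARGED MODULO EXACTLY plan g77's announced V17 STUB BODIES — NO SIGN OF β** — [15] Prop. 8's top step `Prop8RegSepTopStep F 2 suppDom B₃ a₀ a₁` with `2L² ≤ B₃`, `0 < a₀`, `0 < a₁` (stub 1 `Prop8StepCoPAt F` opened), [6] Prop. 6 at NODE 00's member `B8.Prop6Printed 4 L B₁ c₁ (zdCub (MatA 2) L ·)` with `0 ≤ B₁`, `0 < c₁` (stub 2 `Prop6MemberB8At F` opened), the window `0 < γ ≤ ½`, the thresholds `0 < ε₀`, `0 < ε₂₉` and the SIGN-FREE windowed β-box `BetaLowerH bₗ γ ∕ BetaUpperH β' γ` with the two letters `−bₗ·γ² ≤ 3`, `β'·γ² ≤ ¾` of the β OF RECORD OF V15's WITNESS `betaOfRecord₁₃ F 2 θ₁₅ᶜᶜᴹ(3; ε₀, ε₂₉; B₃, B₃', a₀, a₁')` (= stub 3ᴬ «`−β′ ≤ β ≤ β′` on `]0, γ₀]`» after ONE window-shrinking by dag-n21-c FILE Cʷ′ `windowLettersBox_of_absBetaBox`,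 `γ := min γ₀ (min ½ (1+β′)⁻¹)`, `bₗ := −β′`; on the box it is the window edition's β, dag-n21-c `betaLowerH∕betaUpperH_theta13OfThm1CCMW_of_half`) for ANY gauge constant `B₃' ≥ b9Of·B₃` and ceiling `0 < a₁' ≤ min a₁ (a0Of∕B₃)` (V17's exact letters with `le_rfl`); door provisos BY NAME (§0) through dag-n07-e's bridge, FILE C's window-blind `gauge9R_cube_of_prop8TopStep_of_prop6Member`, B′'s `.mono ∕ .of_le`, FILE Dʷ's `hcompBoth_…_of_betaBoxSignFree_half` and Part 11's pointed §0a (FILE Eʷ ★★★ʷʰ) — AT THE V16 WITNESS SHAPE `Stage13HParams.ofHistoryBlind ⟨θ₁₅ᶜᶜᴹᵂ, ZrOfRecord₁₃ θ₁₅ᶜᶜᴹᵂ⟩` (the history-blind door over the cured residual of the windowed collared `θ₁₅ᶜᶜᴹᵂ(j; γ) = theta13OfThm1CCMW F N j γ ε₀ ε₂₉ B₃ B₃' a₀ a₁`, `0 < γ ≤ ½`; `= ofHistoryBlind (Stage13RParams.ofCured θ₁₅ᶜᶜᴹᵂ)`, `rfl`) — ITEM K1⁷'s θ-KEYED CONSEQUENT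 WITNESSED BY `(θ, hP)` FROM THE POINTED CHILDREN OVER THE X-REBOUND FOUR-PIN VIEW** (§1 into def-T's
`endStatementBPrinted_of_isRecordOfRecord₁₃CCoPH_of_nodes` + module 38's interval β-binder + module 26's window).  COMPOSITE.
[cite: Balaban1989LargeFieldII, Thm 1 p.355, (0.1) pp.355–356, p.391; Balaban1988Convergent, (3.16)–(3.22) pp.268–269; Balaban1987RG1, Thm 3 p.264, (0.17)–(0.20) pp.255–256 and (1.22) p.264, (2.9) p.266; Balaban1985UV3, Thm 1 p.257 (bookkeeping + elementary window)] (= `N24_stabilityBR13SepCoPH_thetaShape20_rebindX_fourPin_pointed` at `θ := the door`; `Admissible` ← dag-n21-c `admissible_theta13OfThm1CCMW_of_le_half` (window + six signs), `SlotsNondegenerate₁₃` ← dag-n21-c `slotsNondegenerate₁₃_theta13OfThm1CCMW` (hypothesis-free), N13's (R₁₃) ← §0 `N24_laws₁₃CoPH_theta13OfThm1CCMW` (= dag-n11-e's generic `rOpLeaf_VOfRecord₁₃CoPH_theta13LiveOfNumerics` at the member) — ALL BY NAME; the β-box pair `hlo ∕ hhi` read at the witness's β of record `betaOfRecord₁₃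 F N θ₁₅ᶜᶜᴹᵂ` (def-T `βfun_datumOfRecord₁₃SepCoPH`, `rfl`) = the currency of V16's stub 3ʷ (there at `j = 3` on the window `γ = θ₁₅ᶜᶜᴹᵂ.γ`, so the world takes `w.γ ≤ γ`); the unity guard DISCHARGED by `Stage13RParams.ZrUnity.ofHistoryBlind` over K0a FILE 17 `finsum_ζ0_ZrOfRecord₁₃`; `hP : (…).Provisos₁₃SepCoPH F N` at the door — the K0⁷ skeleton's own product — is the ONLY K0-side hypothesis left.) (= `N24_stabilityBR13SepCoPH_thetaShape20_rebindX_fourPin_pointed_theta13OfThm1CCMW_door` with `hP := §0`; signs `0 ≤ B₃` from the floor, `0 ≤ B₃'` from `0 ≤ b9Of·B₃ ≤ B₃'` (`b9Of_pos`); the WORLD's β-box letters `hlo ∕ hhi` (on `]0, w.γ]`, `w.γ ≤ γ`; present in the consequent ∕ rung-2 forms only) stay the closer's — the UPPER one is the K0 box's `hbox'` at `w.βup = β'` (through dag-n21-c `betaUpperH_theta13OfThm1CCMW_of_half hγh`); the LOWER one reads `0 < w.b` (`WorldP.b_pos`) = NODE O's positive lower bound on β, NOT supplied by the sign-free K0 box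 (`bₗ` may be ≤ 0).) -/
theorem N24_stabilityBR13SepCoPH_thetaShape20_rebindX_fourPin_pointed_theta13OfThm1CCMW_cube_of_prop8TopStep_of_prop6Member_of_betaBoxSignFree_allTorus_door {B₃ a₀ a₁ B₁ c₁ B₃' a₁' : ℝ} (hB₃ : 2 * (F.L : ℝ) ^ 2 ≤ B₃) (ha₀ : 0 < a₀)
    (h8 : Prop8RegSepTopStep F 2 (fun ν K Ω => suppDomOfRecord F ν K Ω) B₃ a₀ a₁) (hB₁ : 0 ≤ B₁) (hc₁ : 0 < c₁)
    (hP6 : letI : CStarAlgebra (MatA 2) := {}; B8.Prop6Printed 4 (F.L : ℝ) B₁ c₁ (fun i : B8LeafModelZd.ZdIdx 4 F.L => zdCub (MatA 2) F.L i))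
    (hB₉ : b9Of F (F.L ^ 3) B₁ * B₃ ≤ B₃') (ha₁' : 0 < a₁') (ha₁'le : a₁' ≤ min a₁ (a0Of F 2 (F.L ^ 3) B₁ c₁ / B₃))
    {γ ε₀ ε₂₉ : ℝ} (hγ₀ : 0 < γ) (hγh : γ ≤ 1 / 2) (hε : 0 < ε₀) (hε' : 0 < ε₂₉) {bl β' : ℝ} (hbox : BetaLowerH bl γ (betaOfRecord₁₃ F 2 (theta13OfThm1CCM F 2 3 ε₀ ε₂₉ B₃ B₃' a₀ a₁')))
    (hbox' : BetaUpperH β' γ (betaOfRecord₁₃ F 2 (theta13OfThm1CCM F 2 3 ε₀ ε₂₉ B₃ B₃' a₀ a₁'))) (hl : -bl * γ ^ 2 ≤ 3) (hβ' : β' * γ ^ 2 ≤ 3 / 4)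
    (X' : B12.RunParams → PrintedCarriersR)
    (Mstar : ℕ)
    (ops : OpsY 2 (theta13OfThm1CCMW F 2 3 γ ε₀ ε₂₉ B₃ B₃' a₀ a₁').toStage3Params Mstar)
    (ζ : ResidZ F 2)
    (lamW : ResidW F 2)
    (w : WorldP)
    (hC : w.C = (datumOfRecord₁₃SepCoPH F 2 (Stage13HParams.ofHistoryBlind F 2 ⟨theta13OfThm1CCMW F 2 3 γ ε₀ ε₂₉ B₃ B₃' a₀ a₁', ZrOfRecord₁₃ F 2 (theta13OfThm1CCMW F 2 3 γ ε₀ ε₂₉ B₃ B₃' a₀ a₁')⟩) (N24_provisos₁₃SepCoPH_door_theta13OfThm1CCMW_cube_of_prop8TopStep_of_prop6Member_of_betaBoxSignFree_allTorus F hB₃ ha₀ h8 hB₁ hc₁ hP6 hB₉ ha₁' ha₁'le hγ₀ hγh hε hε' hbox hbox' hl hβ')).C)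
    (hγ : 0 < w.γ ∧ w.γ ≤ (theta13OfThm1CCMW F 2 3 γ ε₀ ε₂₉ B₃ B₃' a₀ a₁').γ)
    (hL : w.L = ((theta13OfThm1CCMW F 2 3 γ ε₀ ε₂₉ B₃ B₃' a₀ a₁').L : ℝ))
    (hup : ∀ P, w.up P = upOfRecord₅C F 2 (((Stage13HParams.ofHistoryBlind F 2 ⟨theta13OfThm1CCMW F 2 3 γ ε₀ ε₂₉ B₃ B₃' a₀ a₁', ZrOfRecord₁₃ F 2 (theta13OfThm1CCMW F 2 3 γ ε₀ ε₂₉ B₃ B₃' a₀ a₁')⟩).rebindX F 2 X').view₁₃CoPHB10YZW F 2 Mstar ops ζ lamW) P)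
    (h05 : ∀ P : B12.RunParams,
      B8LeafR (X' P).d8 (X' P).L8 (X' P).C₂ (X' P).B₁' (X' P).B₀' (X' P).B₁ (X' P).B₂ (X' P).c₁
        (X' P).inp8 (X' P).B₀β (X' P).loc8 (X' P).fam8R (X' P).lan8 (X' P).cub8 (X' P).toAxial8)
    (h06 : B9LeafX (Y9OfRecord 2 (theta13OfThm1CCMW F 2 3 γ ε₀ ε₂₉ B₃ B₃' a₀ a₁').toStage3Params Mstar ops))
    (h07 : B11Leaf (Z11OfRecord F 2 ζ))
    (h08 : PrintedUV3V 2 (theta13OfThm1CCMW F 2 3 γ ε₀ ε₂₉ B₃ B₃' a₀ a₁').L)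
    (h09 : ∀ P : B12.RunParams, B12Sec2to5.Lemma4Printed (X' P).F12 (X' P).c12)
    (h09T : ∀ P : B12.RunParams, (leavesP w P).smallCouplings → (leavesP w P).smallFieldInductive)
    (h10 : ∀ P : B12.RunParams, B9LeafX (Y9OfRecord 2 (theta13OfThm1CCMW F 2 3 γ ε₀ ε₂₉ B₃ B₃' a₀ a₁').toStage3Params Mstar ops) →
      (B10.Thm1PrintedCompact ((((Stage13HParams.ofHistoryBlind F 2 ⟨theta13OfThm1CCMW F 2 3 γ ε₀ ε₂₉ B₃ B₃' a₀ a₁', ZrOfRecord₁₃ F 2 (theta13OfThm1CCMW F 2 3 γ ε₀ ε₂₉ B₃ B₃' a₀ a₁')⟩).rebindX F 2 X').view₁₃CoPHB10YZW F 2 Mstar ops ζ lamW).res.X P).runs10 ∧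
          B10.Thm2Printed ((((Stage13HParams.ofHistoryBlind F 2 ⟨theta13OfThm1CCMW F 2 3 γ ε₀ ε₂₉ B₃ B₃' a₀ a₁', ZrOfRecord₁₃ F 2 (theta13OfThm1CCMW F 2 3 γ ε₀ ε₂₉ B₃ B₃' a₀ a₁')⟩).rebindX F 2 X').view₁₃CoPHB10YZW F 2 Mstar ops ζ lamW).res.X P).runs10) →
        B11Leaf (Z11OfRecord F 2 ζ) → B12Sec2to5.Lemma4Printed (X' P).F12 (X' P).c12 →
          B13.Lemma1Printed (X' P).S13 (X' P).c13 ∧ B13.Lemma2Printed (X' P).S13 (X' P).c13 ∧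
            B13.Lemma3Printed (X' P).S13 (X' P).c13)
    (h11 : ∀ P : B12.RunParams, (leavesP w P).b7 → (leavesP w P).b8 → (leavesP w P).b9 → (leavesP w P).b10 → (leavesP w P).b11 →
      (leavesP w P).smallCouplings → (leavesP w P).smallFieldInductive → (leavesP w P).flowControl →
        ∀ k, k < P.K → SLaw₁₃CoPH F 2 (Stage13HParams.ofHistoryBlind F 2 ⟨theta13OfThm1CCMW F 2 3 γ ε₀ ε₂₉ B₃ B₃' a₀ a₁', ZrOfRecord₁₃ F 2 (theta13OfThm1CCMW F 2 3 γ ε₀ ε₂₉ B₃ B₃' a₀ a₁')⟩) P k → TLaw₁₃CoPH F 2 (Stage13HParams.ofHistoryBlind F 2 ⟨theta13OfThm1CCMW F 2 3 γ ε₀ ε₂₉ B₃ B₃' a₀ a₁', ZrOfRecord₁₃ F 2 (theta13OfThm1CCMW F 2 3 γ ε₀ ε₂₉ B₃ B₃' a₀ a₁')⟩) P k)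
    (h12 : ∀ P : B12.RunParams, B15Leaf (WOfRecord₁₃ F 2 (theta13OfThm1CCMW F 2 3 γ ε₀ ε₂₉ B₃ B₃' a₀ a₁') lamW P))
    (hUV : ∀ P : B12.RunParams, (genFlow (betaOfRecord₁₃ F 2 (theta13OfThm1CCMW F 2 3 γ ε₀ ε₂₉ B₃ B₃' a₀ a₁')) P.g0).InInterval w.γ P.K → ∀ k, k ≤ P.K → SLaw₁₃CoPH F 2 (Stage13HParams.ofHistoryBlind F 2 ⟨theta13OfThm1CCMW F 2 3 γ ε₀ ε₂₉ B₃ B₃' a₀ a₁', ZrOfRecord₁₃ F 2 (theta13OfThm1CCMW F 2 3 γ ε₀ ε₂₉ B₃ B₃' a₀ a₁')⟩) P k →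
      ∀ U : GaugeField (F.P P.K) k (SU 2),
        chiβOfRecord₁₃ F 2 (theta13OfThm1CCMW F 2 3 γ ε₀ ε₂₉ B₃ B₃' a₀ a₁') P.K (gOfRecord₁₃ F 2 (theta13OfThm1CCMW F 2 3 γ ε₀ ε₂₉ B₃ B₃' a₀ a₁') P) k U *
              Real.exp (-(1 / (gOfRecord₁₃ F 2 (theta13OfThm1CCMW F 2 3 γ ε₀ ε₂₉ B₃ B₃' a₀ a₁') P k) ^ 2 * wilsonBGOfRecord F 2 (theta13OfThm1CCMW F 2 3 γ ε₀ ε₂₉ B₃ B₃' a₀ a₁').εbg P k U)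
                - w.em (gOfRecord₁₃ F 2 (theta13OfThm1CCMW F 2 3 γ ε₀ ε₂₉ B₃ B₃' a₀ a₁') P k) * (Fintype.card (Site (F.P P.K) k) : ℝ)) ≤ densOfRecord₁₃ F 2 (theta13OfThm1CCMW F 2 3 γ ε₀ ε₂₉ B₃ B₃' a₀ a₁') P k U ∧
        densOfRecord₁₃ F 2 (theta13OfThm1CCMW F 2 3 γ ε₀ ε₂₉ B₃ B₃' a₀ a₁') P k U ≤ Real.exp (w.ep (gOfRecord₁₃ F 2 (theta13OfThm1CCMW F 2 3 γ ε₀ ε₂₉ B₃ B₃' a₀ a₁') P k) * (Fintype.card (Site (F.P P.K) k) : ℝ)))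
    (hlo : BetaLowerH w.b w.γ (betaOfRecord₁₃ F 2 (theta13OfThm1CCMW F 2 3 γ ε₀ ε₂₉ B₃ B₃' a₀ a₁')))
    (hhi : BetaUpperH w.βup w.γ (betaOfRecord₁₃ F 2 (theta13OfThm1CCMW F 2 3 γ ε₀ ε₂₉ B₃ B₃' a₀ a₁'))) :
    ∃ (θ' : Stage13HParams F 2) (h' : θ'.Provisos₁₃SepCoPH F 2), (θ'.ZhUnity F 2 ∧ θ'.SlotsNondegenerate₁₃ F 2) ∧ θ'.Admissible F 2 ∧
      B16.EndStatementBPrinted (datumOfRecord₁₃SepCoPH F 2 θ' h').C ∧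
      ∃ γ₁ : ℝ, 0 < γ₁ ∧ ∀ γ : ℝ, 0 < γ → γ ≤ γ₁ → ∃ P : B12.RunParams, 1 ≤ P.K ∧ ((datumOfRecord₁₃SepCoPH F 2 θ' h').C P).flow.InInterval γ P.K := by
  have hL0 : (0 : ℝ) < (F.L : ℝ) := by exact_mod_cast lt_trans Nat.zero_lt_one F.hL.2
  have hBpos : (0 : ℝ) < B₃ := lt_of_lt_of_le (mul_pos two_pos (pow_pos hL0 2)) hB₃
  have hB9 : (0 : ℝ) ≤ B₃' := (mul_nonneg (b9Of_pos (F := F) (F.L ^ 3) hB₁).le hBpos.le).trans hB₉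
  exact N24_stabilityBR13SepCoPH_thetaShape20_rebindX_fourPin_pointed_theta13OfThm1CCMW_door (F := F) (N := 2) hγ₀ hγh hε hε' hBpos.le hB9 ha₀ ha₁' (N24_provisos₁₃SepCoPH_door_theta13OfThm1CCMW_cube_of_prop8TopStep_of_prop6Member_of_betaBoxSignFree_allTorus F hB₃ ha₀ h8 hB₁ hc₁ hP6 hB₉ ha₁' ha₁'le hγ₀ hγh hε hε' hbox hbox' hl hβ') X' Mstar ops ζ lamW w hC hγ hL hup h05 h06 h07 h08 h09 h09T h10 h11 h12 hUV hlo hhi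

/-- **AT THE V17 WITNESS (EVERY family `F` — no `4 ≤ F.m`), `N = 2`, `j = 3`, WITH `hP` DISCHARGED MODULO EXACTLY plan g77's announced V17 STUB BODIES — NO SIGN OF β** — [15] Prop. 8's top step `Prop8RegSepTopStep F 2 suppDom B₃ a₀ a₁` with `2L² ≤ B₃`, `0 < a₀`, `0 < a₁` (stub 1 `Prop8StepCoPAt F` opened), [6] Prop. 6 at NODE 00's member `B8.Prop6Printed 4 L B₁ c₁ (zdCub (MatA 2) L ·)` with `0 ≤ B₁`, `0 < c₁` (stub 2 `Prop6MemberB8At F` opened), the window `0 < γ ≤ ½`, the thresholds `0 < ε₀`, `0 < ε₂₉` and the SIGN-FREE windowed β-box `BetaLowerH bₗ γ ∕ BetaUpperH β' γ` with the two letters `−bₗ·γ² ≤ 3`, `β'·γ² ≤ ¾` of the β OF RECORD OF V15's WITNESS `betaOfRecord₁₃ F 2 θ₁₅ᶜᶜᴹ(3; ε₀, ε₂₉; B₃, B₃', a₀, a₁')` (= stub 3ᴬ «`−β′ ≤ β ≤ β′` on `]0, γ₀]`» after ONE window-shrinking by dag-n21-c FILE Cʷ′ `windowLettersBox_of_absBetaBox`,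 `γ := min γ₀ (min ½ (1+β′)⁻¹)`, `bₗ := −β′`; on the box it is the window edition's β, dag-n21-c `betaLowerH∕betaUpperH_theta13OfThm1CCMW_of_half`) for ANY gauge constant `B₃' ≥ b9Of·B₃` and ceiling `0 < a₁' ≤ min a₁ (a0Of∕B₃)` (V17's exact letters with `le_rfl`); door provisos BY NAME (§0) through dag-n07-e's bridge, FILE C's window-blind `gauge9R_cube_of_prop8TopStep_of_prop6Member`, B′'s `.mono ∕ .of_le`, FILE Dʷ's `hcompBoth_…_of_betaBoxSignFree_half` and Part 11's pointed §0a (FILE Eʷ ★★★ʷʰ) — AT THE V16 WITNESS SHAPE `Stage13HParams.ofHistoryBlind ⟨θ₁₅ᶜᶜᴹᵂ, ZrOfRecord₁₃ θ₁₅ᶜᶜᴹᵂ⟩` (the history-blind door over the cured residual of the windowed collared `θ₁₅ᶜᶜᴹᵂ(j; γ) = theta13OfThm1CCMW F N j γ ε₀ ε₂₉ B₃ B₃' a₀ a₁`, `0 < γ ≤ ½`; `= ofHistoryBlind (Stage13RParams.ofCured θ₁₅ᶜᶜᴹᵂ)`, `rfl`) — THE ∃-BODY OF `BetaWindowAtSomeRecord13`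 OVER THE X-REBOUND FOUR-PIN VIEW**, witnesses `(θ, hP, w)` (guard `hU` displayed).
[cite: Balaban1989LargeFieldII, Thm 1 p.355, (0.1) pp.355–356, p.391; Balaban1987RG1, Thm 3 p.264, (0.17)–(0.20) pp.255–256 and (1.22) p.264, (2.9) p.266; Balaban1985UV3, Thm 1 p.257 (bookkeeping + elementary window)] (= `N24_betaWindowAtSomeRecord₁₃SepCoPH_of_rebindX_fourPin_pointed_of_boxH` at `θ := the door`; `Admissible` ← dag-n21-c `admissible_theta13OfThm1CCMW_of_le_half` (window + six signs), `SlotsNondegenerate₁₃` ← dag-n21-c `slotsNondegenerate₁₃_theta13OfThm1CCMW` (hypothesis-free), N13's (R₁₃) ← §0 `N24_laws₁₃CoPH_theta13OfThm1CCMW` (= dag-n11-e's generic `rOpLeaf_VOfRecord₁₃CoPH_theta13LiveOfNumerics` at the member) — ALL BY NAME; the β-box pair `hlo ∕ hhi` read at the witness's β of record `betaOfRecord₁₃ F N θ₁₅ᶜᶜᴹᵂ` (def-T `βfun_datumOfRecord₁₃SepCoPH`, `rfl`) = the currency of V16's stub 3ʷ (there at `j = 3` on the window `γ = θ₁₅ᶜᶜᴹᵂ.γ`,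 so the world takes `w.γ ≤ γ`); the unity guard DISCHARGED by `Stage13RParams.ZrUnity.ofHistoryBlind` over K0a FILE 17 `finsum_ζ0_ZrOfRecord₁₃`; `hP : (…).Provisos₁₃SepCoPH F N` at the door — the K0⁷ skeleton's own product — is the ONLY K0-side hypothesis left.) (= `N24_betaWindowAtSomeRecord₁₃SepCoPH_of_rebindX_fourPin_pointed_of_boxH_theta13OfThm1CCMW_door` with `hP := §0`; signs `0 ≤ B₃` from the floor, `0 ≤ B₃'` from `0 ≤ b9Of·B₃ ≤ B₃'` (`b9Of_pos`); the WORLD's β-box letters `hlo ∕ hhi` (on `]0, w.γ]`, `w.γ ≤ γ`; present in the consequent ∕ rung-2 forms only) stay the closer's — the UPPER one is the K0 box's `hbox'` at `w.βup = β'` (through dag-n21-c `betaUpperH_theta13OfThm1CCMW_of_half hγh`); the LOWER one reads `0 < w.b` (`WorldP.b_pos`) = NODE O's positive lower bound on β, NOT supplied by the sign-free K0 box (`bₗ` may be ≤ 0).) -/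
theorem N24_betaWindowAtSomeRecord₁₃SepCoPH_of_rebindX_fourPin_pointed_of_boxH_theta13OfThm1CCMW_cube_of_prop8TopStep_of_prop6Member_of_betaBoxSignFree_allTorus_door {B₃ a₀ a₁ B₁ c₁ B₃' a₁' : ℝ} (hB₃ : 2 * (F.L : ℝ) ^ 2 ≤ B₃) (ha₀ : 0 < a₀)
    (h8 : Prop8RegSepTopStep F 2 (fun ν K Ω => suppDomOfRecord F ν K Ω) B₃ a₀ a₁) (hB₁ : 0 ≤ B₁) (hc₁ : 0 < c₁)
    (hP6 : letI : CStarAlgebra (MatA 2) := {}; B8.Prop6Printed 4 (F.L : ℝ) B₁ c₁ (fun i : B8LeafModelZd.ZdIdx 4 F.L => zdCub (MatA 2) F.L i))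
    (hB₉ : b9Of F (F.L ^ 3) B₁ * B₃ ≤ B₃') (ha₁' : 0 < a₁') (ha₁'le : a₁' ≤ min a₁ (a0Of F 2 (F.L ^ 3) B₁ c₁ / B₃))
    {γ ε₀ ε₂₉ : ℝ} (hγ₀ : 0 < γ) (hγh : γ ≤ 1 / 2) (hε : 0 < ε₀) (hε' : 0 < ε₂₉) {bl β' : ℝ} (hbox : BetaLowerH bl γ (betaOfRecord₁₃ F 2 (theta13OfThm1CCM F 2 3 ε₀ ε₂₉ B₃ B₃' a₀ a₁')))
    (hbox' : BetaUpperH β' γ (betaOfRecord₁₃ F 2 (theta13OfThm1CCM F 2 3 ε₀ ε₂₉ B₃ B₃' a₀ a₁'))) (hl : -bl * γ ^ 2 ≤ 3) (hβ' : β' * γ ^ 2 ≤ 3 / 4)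
    (X' : B12.RunParams → PrintedCarriersR)
    (Mstar : ℕ)
    (ops : OpsY 2 (theta13OfThm1CCMW F 2 3 γ ε₀ ε₂₉ B₃ B₃' a₀ a₁').toStage3Params Mstar)
    (ζ : ResidZ F 2)
    (lamW : ResidW F 2)
    (w : WorldP)
    (hC : w.C = (datumOfRecord₁₃SepCoPH F 2 (Stage13HParams.ofHistoryBlind F 2 ⟨theta13OfThm1CCMW F 2 3 γ ε₀ ε₂₉ B₃ B₃' a₀ a₁', ZrOfRecord₁₃ F 2 (theta13OfThm1CCMW F 2 3 γ ε₀ ε₂₉ B₃ B₃' a₀ a₁')⟩) (N24_provisos₁₃SepCoPH_door_theta13OfThm1CCMW_cube_of_prop8TopStep_of_prop6Member_of_betaBoxSignFree_allTorus F hB₃ ha₀ h8 hB₁ hc₁ hP6 hB₉ ha₁' ha₁'le hγ₀ hγh hε hε' hbox hbox' hl hβ')).C)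
    (hγ : 0 < w.γ ∧ w.γ ≤ (theta13OfThm1CCMW F 2 3 γ ε₀ ε₂₉ B₃ B₃' a₀ a₁').γ)
    (hL : w.L = ((theta13OfThm1CCMW F 2 3 γ ε₀ ε₂₉ B₃ B₃' a₀ a₁').L : ℝ))
    (hup : ∀ P, w.up P = upOfRecord₅C F 2 (((Stage13HParams.ofHistoryBlind F 2 ⟨theta13OfThm1CCMW F 2 3 γ ε₀ ε₂₉ B₃ B₃' a₀ a₁', ZrOfRecord₁₃ F 2 (theta13OfThm1CCMW F 2 3 γ ε₀ ε₂₉ B₃ B₃' a₀ a₁')⟩).rebindX F 2 X').view₁₃CoPHB10YZW F 2 Mstar ops ζ lamW) P)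
    (h05 : ∀ P : B12.RunParams,
      B8LeafR (X' P).d8 (X' P).L8 (X' P).C₂ (X' P).B₁' (X' P).B₀' (X' P).B₁ (X' P).B₂ (X' P).c₁
        (X' P).inp8 (X' P).B₀β (X' P).loc8 (X' P).fam8R (X' P).lan8 (X' P).cub8 (X' P).toAxial8)
    (h06 : B9LeafX (Y9OfRecord 2 (theta13OfThm1CCMW F 2 3 γ ε₀ ε₂₉ B₃ B₃' a₀ a₁').toStage3Params Mstar ops))
    (h07 : B11Leaf (Z11OfRecord F 2 ζ))
    (h08 : PrintedUV3V 2 (theta13OfThm1CCMW F 2 3 γ ε₀ ε₂₉ B₃ B₃' a₀ a₁').L)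
    (h09 : ∀ P : B12.RunParams, B12Sec2to5.Lemma4Printed (X' P).F12 (X' P).c12)
    (h09T : ∀ P : B12.RunParams, (leavesP w P).smallCouplings → (leavesP w P).smallFieldInductive)
    (h10 : ∀ P : B12.RunParams, B9LeafX (Y9OfRecord 2 (theta13OfThm1CCMW F 2 3 γ ε₀ ε₂₉ B₃ B₃' a₀ a₁').toStage3Params Mstar ops) →
      (B10.Thm1PrintedCompact ((((Stage13HParams.ofHistoryBlind F 2 ⟨theta13OfThm1CCMW F 2 3 γ ε₀ ε₂₉ B₃ B₃' a₀ a₁', ZrOfRecord₁₃ F 2 (theta13OfThm1CCMW F 2 3 γ ε₀ ε₂₉ B₃ B₃' a₀ a₁')⟩).rebindX F 2 X').view₁₃CoPHB10YZW F 2 Mstar ops ζ lamW).res.X P).runs10 ∧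
          B10.Thm2Printed ((((Stage13HParams.ofHistoryBlind F 2 ⟨theta13OfThm1CCMW F 2 3 γ ε₀ ε₂₉ B₃ B₃' a₀ a₁', ZrOfRecord₁₃ F 2 (theta13OfThm1CCMW F 2 3 γ ε₀ ε₂₉ B₃ B₃' a₀ a₁')⟩).rebindX F 2 X').view₁₃CoPHB10YZW F 2 Mstar ops ζ lamW).res.X P).runs10) →
        B11Leaf (Z11OfRecord F 2 ζ) → B12Sec2to5.Lemma4Printed (X' P).F12 (X' P).c12 →
          B13.Lemma1Printed (X' P).S13 (X' P).c13 ∧ B13.Lemma2Printed (X' P).S13 (X' P).c13 ∧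
            B13.Lemma3Printed (X' P).S13 (X' P).c13)
    (h11 : ∀ P : B12.RunParams, (leavesP w P).b7 → (leavesP w P).b8 → (leavesP w P).b9 → (leavesP w P).b10 → (leavesP w P).b11 →
      (leavesP w P).smallCouplings → (leavesP w P).smallFieldInductive → (leavesP w P).flowControl →
        ∀ k, k < P.K → SLaw₁₃CoPH F 2 (Stage13HParams.ofHistoryBlind F 2 ⟨theta13OfThm1CCMW F 2 3 γ ε₀ ε₂₉ B₃ B₃' a₀ a₁', ZrOfRecord₁₃ F 2 (theta13OfThm1CCMW F 2 3 γ ε₀ ε₂₉ B₃ B₃' a₀ a₁')⟩) P k → TLaw₁₃CoPH F 2 (Stage13HParams.ofHistoryBlind F 2 ⟨theta13OfThm1CCMW F 2 3 γ ε₀ ε₂₉ B₃ B₃' a₀ a₁', ZrOfRecord₁₃ F 2 (theta13OfThm1CCMW F 2 3 γ ε₀ ε₂₉ B₃ B₃' a₀ a₁')⟩) P k)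
    (h12 : ∀ P : B12.RunParams, B15Leaf (WOfRecord₁₃ F 2 (theta13OfThm1CCMW F 2 3 γ ε₀ ε₂₉ B₃ B₃' a₀ a₁') lamW P))
    (hUV : ∀ P : B12.RunParams, (genFlow (betaOfRecord₁₃ F 2 (theta13OfThm1CCMW F 2 3 γ ε₀ ε₂₉ B₃ B₃' a₀ a₁')) P.g0).InInterval w.γ P.K → ∀ k, k ≤ P.K → SLaw₁₃CoPH F 2 (Stage13HParams.ofHistoryBlind F 2 ⟨theta13OfThm1CCMW F 2 3 γ ε₀ ε₂₉ B₃ B₃' a₀ a₁', ZrOfRecord₁₃ F 2 (theta13OfThm1CCMW F 2 3 γ ε₀ ε₂₉ B₃ B₃' a₀ a₁')⟩) P k →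
      ∀ U : GaugeField (F.P P.K) k (SU 2),
        chiβOfRecord₁₃ F 2 (theta13OfThm1CCMW F 2 3 γ ε₀ ε₂₉ B₃ B₃' a₀ a₁') P.K (gOfRecord₁₃ F 2 (theta13OfThm1CCMW F 2 3 γ ε₀ ε₂₉ B₃ B₃' a₀ a₁') P) k U *
              Real.exp (-(1 / (gOfRecord₁₃ F 2 (theta13OfThm1CCMW F 2 3 γ ε₀ ε₂₉ B₃ B₃' a₀ a₁') P k) ^ 2 * wilsonBGOfRecord F 2 (theta13OfThm1CCMW F 2 3 γ ε₀ ε₂₉ B₃ B₃' a₀ a₁').εbg P k U)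
                - w.em (gOfRecord₁₃ F 2 (theta13OfThm1CCMW F 2 3 γ ε₀ ε₂₉ B₃ B₃' a₀ a₁') P k) * (Fintype.card (Site (F.P P.K) k) : ℝ)) ≤ densOfRecord₁₃ F 2 (theta13OfThm1CCMW F 2 3 γ ε₀ ε₂₉ B₃ B₃' a₀ a₁') P k U ∧
        densOfRecord₁₃ F 2 (theta13OfThm1CCMW F 2 3 γ ε₀ ε₂₉ B₃ B₃' a₀ a₁') P k U ≤ Real.exp (w.ep (gOfRecord₁₃ F 2 (theta13OfThm1CCMW F 2 3 γ ε₀ ε₂₉ B₃ B₃' a₀ a₁') P k) * (Fintype.card (Site (F.P P.K) k) : ℝ)))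
    (hlo : BetaLowerH w.b w.γ (betaOfRecord₁₃ F 2 (theta13OfThm1CCMW F 2 3 γ ε₀ ε₂₉ B₃ B₃' a₀ a₁')))
    (hhi : BetaUpperH w.βup w.γ (betaOfRecord₁₃ F 2 (theta13OfThm1CCMW F 2 3 γ ε₀ ε₂₉ B₃ B₃' a₀ a₁'))) :
    ∃ (θ' : Stage13HParams F 2) (h' : θ'.Provisos₁₃SepCoPH F 2) (w' : WorldP), (θ'.ZhUnity F 2 ∧ θ'.SlotsNondegenerate₁₃ F 2) ∧ θ'.Admissible F 2 ∧
      IsRecordOfRecord₁₃CSepCoPH F 2 (datumOfRecord₁₃SepCoPH F 2 θ' h') w' ∧ (∀ P : B12.RunParams, Nodes (leavesP w' P)) ∧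
      BetaBoundsInInterval w'.C.toB12 w'.γ w'.b w'.βup ∧
      ∃ γ₁ : ℝ, 0 < γ₁ ∧ ∀ γ : ℝ, 0 < γ → γ ≤ γ₁ → ∃ P : B12.RunParams, 1 ≤ P.K ∧ ((datumOfRecord₁₃SepCoPH F 2 θ' h').C P).flow.InInterval γ P.K := by
  have hL0 : (0 : ℝ) < (F.L : ℝ) := by exact_mod_cast lt_trans Nat.zero_lt_one F.hL.2
  have hBpos : (0 : ℝ) < B₃ := lt_of_lt_of_le (mul_pos two_pos (pow_pos hL0 2)) hB₃
  have hB9 : (0 : ℝ) ≤ B₃' := (mul_nonneg (b9Of_pos (F := F) (F.L ^ 3) hB₁).le hBpos.le).trans hB₉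
  exact N24_betaWindowAtSomeRecord₁₃SepCoPH_of_rebindX_fourPin_pointed_of_boxH_theta13OfThm1CCMW_door (F := F) (N := 2) hγ₀ hγh hε hε' hBpos.le hB9 ha₀ ha₁' (N24_provisos₁₃SepCoPH_door_theta13OfThm1CCMW_cube_of_prop8TopStep_of_prop6Member_of_betaBoxSignFree_allTorus F hB₃ ha₀ h8 hB₁ hc₁ hP6 hB₉ ha₁' ha₁'le hγ₀ hγh hε hε' hbox hbox' hl hβ') X' Mstar ops ζ lamW w hC hγ hL hup h05 h06 h07 h08 h09 h09T h10 h11 h12 hUV hlo hhi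

/-- **AT THE V17 WITNESS (EVERY family `F` — no `4 ≤ F.m`), `N = 2`, `j = 3`, WITH `hP` DISCHARGED MODULO EXACTLY plan g77's announced V17 STUB BODIES — NO SIGN OF β** — [15] Prop. 8's top step `Prop8RegSepTopStep F 2 suppDom B₃ a₀ a₁` with `2L² ≤ B₃`, `0 < a₀`, `0 < a₁` (stub 1 `Prop8StepCoPAt F` opened), [6] Prop. 6 at NODE 00's member `B8.Prop6Printed 4 L B₁ c₁ (zdCub (MatA 2) L ·)` with `0 ≤ B₁`, `0 < c₁` (stub 2 `Prop6MemberB8At F` opened), the window `0 < γ ≤ ½`, the thresholds `0 < ε₀`, `0 < ε₂₉` and the SIGN-FREE windowed β-box `BetaLowerH bₗ γ ∕ BetaUpperH β' γ` with the two letters `−bₗ·γ² ≤ 3`, `β'·γ² ≤ ¾` of the β OF RECORD OF V15's WITNESS `betaOfRecord₁₃ F 2 θ₁₅ᶜᶜᴹ(3; ε₀, ε₂₉; B₃, B₃', a₀, a₁')` (= stub 3ᴬ «`−β′ ≤ β ≤ β′` on `]0, γ₀]`» after ONE window-shrinking by dag-n21-c FILE Cʷ′ `windowLettersBox_of_absBetaBox`,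 `γ := min γ₀ (min ½ (1+β′)⁻¹)`, `bₗ := −β′`; on the box it is the window edition's β, dag-n21-c `betaLowerH∕betaUpperH_theta13OfThm1CCMW_of_half`) for ANY gauge constant `B₃' ≥ b9Of·B₃` and ceiling `0 < a₁' ≤ min a₁ (a0Of∕B₃)` (V17's exact letters with `le_rfl`); door provisos BY NAME (§0) through dag-n07-e's bridge, FILE C's window-blind `gauge9R_cube_of_prop8TopStep_of_prop6Member`, B′'s `.mono ∕ .of_le`, FILE Dʷ's `hcompBoth_…_of_betaBoxSignFree_half` and Part 11's pointed §0a (FILE Eʷ ★★★ʷʰ) — AT THE V16 WITNESS SHAPE `Stage13HParams.ofHistoryBlind ⟨θ₁₅ᶜᶜᴹᵂ, ZrOfRecord₁₃ θ₁₅ᶜᶜᴹᵂ⟩` (the history-blind door over the cured residual of the windowed collared `θ₁₅ᶜᶜᴹᵂ(j; γ) = theta13OfThm1CCMW F N j γ ε₀ ε₂₉ B₃ B₃' a₀ a₁`, `0 < γ ≤ ½`; `= ofHistoryBlind (Stage13RParams.ofCured θ₁₅ᶜᶜᴹᵂ)`, `rfl`) — ★ ITEM K1⁷ (stmt-QuantumFields-20542)'s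 θ-KEYED CONSEQUENT, WITNESSED BY `(θ, hP)`, FROM THE POINTED CHILDREN ON N05's SURVIVING ROUTE** — the world S-bound to the four-pin
view of the H-pinned parameter, N05 ← the repaired surviving slot; (B) by the previous theorem at `hP.toCore` (datum bridge `rfl`), window by module 26.
COMPOSITE: nothing is discharged. [cite: Balaban1989LargeFieldII, Thm 1 p.355, (0.1) pp.355–356, p.391; Balaban1985RegularSpaces, Thm 8 (1.146) p.101; Balaban1987RG1, Thm 3 p.264, (0.17)–(0.20) pp.255–256 and (1.22) p.264; Balaban1985UV3, Thm 1 p.257 (bookkeeping + elementary window)] (= `N24_stabilityBR13SepCoPH_thetaShape20_pinX3HS_fourPin_pointed` at `θ := the door`; `Admissible` ← dag-n21-c `admissible_theta13OfThm1CCMW_of_le_half` (window + six signs), `SlotsNondegenerate₁₃` ← dag-n21-c `slotsNondegenerate₁₃_theta13OfThm1CCMW` (hypothesis-free), N13's (R₁₃) ← §0 `N24_laws₁₃CoPH_theta13OfThm1CCMW` (= dag-n11-e's generic `rOpLeaf_VOfRecord₁₃CoPH_theta13LiveOfNumerics` at the member) — ALL BY NAME; the β-box pair `hlo ∕ hhi`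 read at the witness's β of record `betaOfRecord₁₃ F N θ₁₅ᶜᶜᴹᵂ` (def-T `βfun_datumOfRecord₁₃SepCoPH`, `rfl`) = the currency of V16's stub 3ʷ (there at `j = 3` on the window `γ = θ₁₅ᶜᶜᴹᵂ.γ`, so the world takes `w.γ ≤ γ`); the unity guard DISCHARGED by `Stage13RParams.ZrUnity.ofHistoryBlind` over K0a FILE 17 `finsum_ζ0_ZrOfRecord₁₃`; `hP : (…).Provisos₁₃SepCoPH F N` at the door — the K0⁷ skeleton's own product — is the ONLY K0-side hypothesis left.) (= `N24_stabilityBR13SepCoPH_thetaShape20_pinX3HS_fourPin_pointed_theta13OfThm1CCMW_door` with `hP := §0`; signs `0 ≤ B₃` from the floor, `0 ≤ B₃'` from `0 ≤ b9Of·B₃ ≤ B₃'` (`b9Of_pos`); the WORLD's β-box letters `hlo ∕ hhi` (on `]0, w.γ]`, `w.γ ≤ γ`; present in the consequent ∕ rung-2 forms only) stay the closer's — the UPPER one is the K0 box's `hbox'` at `w.βup = β'` (through dag-n21-c `betaUpperH_theta13OfThm1CCMW_of_half hγh`); the LOWER one reads `0 < w.b` (`WorldP.b_pos`) = NODE O's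 positive lower bound on β, NOT supplied by the sign-free K0 box (`bₗ` may be ≤ 0).) -/
theorem N24_stabilityBR13SepCoPH_thetaShape20_pinX3HS_fourPin_pointed_theta13OfThm1CCMW_cube_of_prop8TopStep_of_prop6Member_of_betaBoxSignFree_allTorus_door {B₃ a₀ a₁ B₁ c₁ B₃' a₁' : ℝ} (hB₃ : 2 * (F.L : ℝ) ^ 2 ≤ B₃) (ha₀ : 0 < a₀)
    (h8 : Prop8RegSepTopStep F 2 (fun ν K Ω => suppDomOfRecord F ν K Ω) B₃ a₀ a₁) (hB₁ : 0 ≤ B₁) (hc₁ : 0 < c₁)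
    (hP6 : letI : CStarAlgebra (MatA 2) := {}; B8.Prop6Printed 4 (F.L : ℝ) B₁ c₁ (fun i : B8LeafModelZd.ZdIdx 4 F.L => zdCub (MatA 2) F.L i))
    (hB₉ : b9Of F (F.L ^ 3) B₁ * B₃ ≤ B₃') (ha₁' : 0 < a₁') (ha₁'le : a₁' ≤ min a₁ (a0Of F 2 (F.L ^ 3) B₁ c₁ / B₃))
    {γ ε₀ ε₂₉ : ℝ} (hγ₀ : 0 < γ) (hγh : γ ≤ 1 / 2) (hε : 0 < ε₀) (hε' : 0 < ε₂₉) {bl β' : ℝ} (hbox : BetaLowerH bl γ (betaOfRecord₁₃ F 2 (theta13OfThm1CCM F 2 3 ε₀ ε₂₉ B₃ B₃' a₀ a₁')))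
    (hbox' : BetaUpperH β' γ (betaOfRecord₁₃ F 2 (theta13OfThm1CCM F 2 3 ε₀ ε₂₉ B₃ B₃' a₀ a₁'))) (hl : -bl * γ ^ 2 ≤ 3) (hβ' : β' * γ ^ 2 ≤ 3 / 4)
    (lam8 : ResidB8 (theta13OfThm1CCMW F 2 3 γ ε₀ ε₂₉ B₃ B₃' a₀ a₁').toStage3Params)
    (lam12 : ResidB12 F 2 (theta13OfThm1CCMW F 2 3 γ ε₀ ε₂₉ B₃ B₃' a₀ a₁').τ9.M)
    (lam13 : B12.RunParams → ResidB13 (theta13OfThm1CCMW F 2 3 γ ε₀ ε₂₉ B₃ B₃' a₀ a₁').toStage3Params)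
    (Mstar : ℕ)
    (ops : OpsY 2 (theta13OfThm1CCMW F 2 3 γ ε₀ ε₂₉ B₃ B₃' a₀ a₁').toStage3Params Mstar)
    (ζ : ResidZ F 2)
    (lamW : ResidW F 2)
    (w : WorldP)
    (hC : w.C = (datumOfRecord₁₃SepCoPH F 2 (Stage13HParams.ofHistoryBlind F 2 ⟨theta13OfThm1CCMW F 2 3 γ ε₀ ε₂₉ B₃ B₃' a₀ a₁', ZrOfRecord₁₃ F 2 (theta13OfThm1CCMW F 2 3 γ ε₀ ε₂₉ B₃ B₃' a₀ a₁')⟩) (N24_provisos₁₃SepCoPH_door_theta13OfThm1CCMW_cube_of_prop8TopStep_of_prop6Member_of_betaBoxSignFree_allTorus F hB₃ ha₀ h8 hB₁ hc₁ hP6 hB₉ ha₁' ha₁'le hγ₀ hγh hε hε' hbox hbox' hl hβ')).C)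
    (hγ : 0 < w.γ ∧ w.γ ≤ (theta13OfThm1CCMW F 2 3 γ ε₀ ε₂₉ B₃ B₃' a₀ a₁').γ)
    (hL : w.L = ((theta13OfThm1CCMW F 2 3 γ ε₀ ε₂₉ B₃ B₃' a₀ a₁').L : ℝ))
    (hup : ∀ P, w.up P = upOfRecord₅CS F 2 (((Stage13HParams.ofHistoryBlind F 2 ⟨theta13OfThm1CCMW F 2 3 γ ε₀ ε₂₉ B₃ B₃' a₀ a₁', ZrOfRecord₁₃ F 2 (theta13OfThm1CCMW F 2 3 γ ε₀ ε₂₉ B₃ B₃' a₀ a₁')⟩).pinX3H F 2 lam8 lam12 lam13).view₁₃CoPHB10YZW F 2 Mstar ops ζ lamW) P)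
    (h05 : B8LeafOfRecordSubBH (theta13OfThm1CCMW F 2 3 γ ε₀ ε₂₉ B₃ B₃' a₀ a₁').toStage3Params lam8)
    (h06 : B9LeafX (Y9OfRecord 2 (theta13OfThm1CCMW F 2 3 γ ε₀ ε₂₉ B₃ B₃' a₀ a₁').toStage3Params Mstar ops))
    (h07 : B11Leaf (Z11OfRecord F 2 ζ))
    (h08 : PrintedUV3V 2 (theta13OfThm1CCMW F 2 3 γ ε₀ ε₂₉ B₃ B₃' a₀ a₁').L)
    (h09 : ∀ P : B12.RunParams, B12Sec2to5.Lemma4Printed (F12OfRecord₁₂ F 2 (theta13OfThm1CCMW F 2 3 γ ε₀ ε₂₉ B₃ B₃' a₀ a₁').toStage12Params lam12 P) (lam12 P).consts)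
    (h09T : ∀ P : B12.RunParams, (leavesP w P).smallCouplings → (leavesP w P).smallFieldInductive)
    (h10 : ∀ P : B12.RunParams, B13LeafOfRecord (theta13OfThm1CCMW F 2 3 γ ε₀ ε₂₉ B₃ B₃' a₀ a₁').toStage3Params (lam13 P))
    (h11 : ∀ P : B12.RunParams, (leavesP w P).b7 → (leavesP w P).b8 → (leavesP w P).b9 → (leavesP w P).b10 → (leavesP w P).b11 →
      (leavesP w P).smallCouplings → (leavesP w P).smallFieldInductive → (leavesP w P).flowControl →
        ∀ k, k < P.K → SLaw₁₃CoPH F 2 (Stage13HParams.ofHistoryBlind F 2 ⟨theta13OfThm1CCMW F 2 3 γ ε₀ ε₂₉ B₃ B₃' a₀ a₁', ZrOfRecord₁₃ F 2 (theta13OfThm1CCMW F 2 3 γ ε₀ ε₂₉ B₃ B₃' a₀ a₁')⟩) P k → TLaw₁₃CoPH F 2 (Stage13HParams.ofHistoryBlind F 2 ⟨theta13OfThm1CCMW F 2 3 γ ε₀ ε₂₉ B₃ B₃' a₀ a₁', ZrOfRecord₁₃ F 2 (theta13OfThm1CCMW F 2 3 γ ε₀ ε₂₉ B₃ B₃' a₀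 a₁')⟩) P k)
    (h12 : ∀ P : B12.RunParams, B15Leaf (WOfRecord₁₃ F 2 (theta13OfThm1CCMW F 2 3 γ ε₀ ε₂₉ B₃ B₃' a₀ a₁') lamW P))
    (hUV : ∀ P : B12.RunParams, (genFlow (betaOfRecord₁₃ F 2 (theta13OfThm1CCMW F 2 3 γ ε₀ ε₂₉ B₃ B₃' a₀ a₁')) P.g0).InInterval w.γ P.K → ∀ k, k ≤ P.K → SLaw₁₃CoPH F 2 (Stage13HParams.ofHistoryBlind F 2 ⟨theta13OfThm1CCMW F 2 3 γ ε₀ ε₂₉ B₃ B₃' a₀ a₁', ZrOfRecord₁₃ F 2 (theta13OfThm1CCMW F 2 3 γ ε₀ ε₂₉ B₃ B₃' a₀ a₁')⟩) P k →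
      ∀ U : GaugeField (F.P P.K) k (SU 2),
        chiβOfRecord₁₃ F 2 (theta13OfThm1CCMW F 2 3 γ ε₀ ε₂₉ B₃ B₃' a₀ a₁') P.K (gOfRecord₁₃ F 2 (theta13OfThm1CCMW F 2 3 γ ε₀ ε₂₉ B₃ B₃' a₀ a₁') P) k U *
              Real.exp (-(1 / (gOfRecord₁₃ F 2 (theta13OfThm1CCMW F 2 3 γ ε₀ ε₂₉ B₃ B₃' a₀ a₁') P k) ^ 2 * wilsonBGOfRecord F 2 (theta13OfThm1CCMW F 2 3 γ ε₀ ε₂₉ B₃ B₃' a₀ a₁').εbg P k U)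
                - w.em (gOfRecord₁₃ F 2 (theta13OfThm1CCMW F 2 3 γ ε₀ ε₂₉ B₃ B₃' a₀ a₁') P k) * (Fintype.card (Site (F.P P.K) k) : ℝ)) ≤ densOfRecord₁₃ F 2 (theta13OfThm1CCMW F 2 3 γ ε₀ ε₂₉ B₃ B₃' a₀ a₁') P k U ∧
        densOfRecord₁₃ F 2 (theta13OfThm1CCMW F 2 3 γ ε₀ ε₂₉ B₃ B₃' a₀ a₁') P k U ≤ Real.exp (w.ep (gOfRecord₁₃ F 2 (theta13OfThm1CCMW F 2 3 γ ε₀ ε₂₉ B₃ B₃' a₀ a₁') P k) * (Fintype.card (Site (F.P P.K) k) : ℝ)))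
    (hlo : BetaLowerH w.b w.γ (betaOfRecord₁₃ F 2 (theta13OfThm1CCMW F 2 3 γ ε₀ ε₂₉ B₃ B₃' a₀ a₁')))
    (hhi : BetaUpperH w.βup w.γ (betaOfRecord₁₃ F 2 (theta13OfThm1CCMW F 2 3 γ ε₀ ε₂₉ B₃ B₃' a₀ a₁'))) :
    ∃ (θ' : Stage13HParams F 2) (h' : θ'.Provisos₁₃SepCoPH F 2), (θ'.ZhUnity F 2 ∧ θ'.SlotsNondegenerate₁₃ F 2) ∧ θ'.Admissible F 2 ∧
      B16.EndStatementBPrinted (datumOfRecord₁₃SepCoPH F 2 θ' h').C ∧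
      ∃ γ₁ : ℝ, 0 < γ₁ ∧ ∀ γ : ℝ, 0 < γ → γ ≤ γ₁ → ∃ P : B12.RunParams, 1 ≤ P.K ∧ ((datumOfRecord₁₃SepCoPH F 2 θ' h').C P).flow.InInterval γ P.K := by
  have hL0 : (0 : ℝ) < (F.L : ℝ) := by exact_mod_cast lt_trans Nat.zero_lt_one F.hL.2
  have hBpos : (0 : ℝ) < B₃ := lt_of_lt_of_le (mul_pos two_pos (pow_pos hL0 2)) hB₃
  have hB9 : (0 : ℝ) ≤ B₃' := (mul_nonneg (b9Of_pos (F := F) (F.L ^ 3) hB₁).le hBpos.le).trans hB₉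
  exact N24_stabilityBR13SepCoPH_thetaShape20_pinX3HS_fourPin_pointed_theta13OfThm1CCMW_door (F := F) (N := 2) hγ₀ hγh hε hε' hBpos.le hB9 ha₀ ha₁' (N24_provisos₁₃SepCoPH_door_theta13OfThm1CCMW_cube_of_prop8TopStep_of_prop6Member_of_betaBoxSignFree_allTorus F hB₃ ha₀ h8 hB₁ hc₁ hP6 hB₉ ha₁' ha₁'le hγ₀ hγh hε hε' hbox hbox' hl hβ') lam8 lam12 lam13 Mstar ops ζ lamW w hC hγ hL hup h05 h06 h07 h08 h09 h09T h10 h11 h12 hUV hlo hhi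

/-- **AT THE V17 WITNESS (EVERY family `F` — no `4 ≤ F.m`), `N = 2`, `j = 3`, WITH `hP` DISCHARGED MODULO EXACTLY plan g77's announced V17 STUB BODIES — NO SIGN OF β** — [15] Prop. 8's top step `Prop8RegSepTopStep F 2 suppDom B₃ a₀ a₁` with `2L² ≤ B₃`, `0 < a₀`, `0 < a₁` (stub 1 `Prop8StepCoPAt F` opened), [6] Prop. 6 at NODE 00's member `B8.Prop6Printed 4 L B₁ c₁ (zdCub (MatA 2) L ·)` with `0 ≤ B₁`, `0 < c₁` (stub 2 `Prop6MemberB8At F` opened), the window `0 < γ ≤ ½`, the thresholds `0 < ε₀`, `0 < ε₂₉` and the SIGN-FREE windowed β-box `BetaLowerH bₗ γ ∕ BetaUpperH β' γ` with the two letters `−bₗ·γ² ≤ 3`, `β'·γ² ≤ ¾` of the β OF RECORD OF V15's WITNESS `betaOfRecord₁₃ F 2 θ₁₅ᶜᶜᴹ(3; ε₀, ε₂₉; B₃, B₃', a₀, a₁')` (= stub 3ᴬ «`−β′ ≤ β ≤ β′` on `]0, γ₀]`» after ONE window-shrinking by dag-n21-c FILE Cʷ′ `windowLettersBox_of_absBetaBox`,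 `γ := min γ₀ (min ½ (1+β′)⁻¹)`, `bₗ := −β′`; on the box it is the window edition's β, dag-n21-c `betaLowerH∕betaUpperH_theta13OfThm1CCMW_of_half`) for ANY gauge constant `B₃' ≥ b9Of·B₃` and ceiling `0 < a₁' ≤ min a₁ (a0Of∕B₃)` (V17's exact letters with `le_rfl`); door provisos BY NAME (§0) through dag-n07-e's bridge, FILE C's window-blind `gauge9R_cube_of_prop8TopStep_of_prop6Member`, B′'s `.mono ∕ .of_le`, FILE Dʷ's `hcompBoth_…_of_betaBoxSignFree_half` and Part 11's pointed §0a (FILE Eʷ ★★★ʷʰ) — AT THE V16 WITNESS SHAPE `Stage13HParams.ofHistoryBlind ⟨θ₁₅ᶜᶜᴹᵂ, ZrOfRecord₁₃ θ₁₅ᶜᶜᴹᵂ⟩` (the history-blind door over the cured residual of the windowed collared `θ₁₅ᶜᶜᴹᵂ(j; γ) = theta13OfThm1CCMW F N j γ ε₀ ε₂₉ B₃ B₃' a₀ a₁`, `0 < γ ≤ ½`; `= ofHistoryBlind (Stage13RParams.ofCured θ₁₅ᶜᶜᴹᵂ)`, `rfl`) — RUNG 1's BODY AT dag-n05-d's H-PIN**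 (`X' := XPinned₁₃H θ λ₈ λ₁₂ λ₁₃`): N05 ← `B8LeafOfRecordSubBH θ₃ λ₈`, N09 ← Lemma 4 at `F12OfRecord₁₂ θ₁₂ λ₁₂`, N10 ← `B13LeafOfRecord θ₃ (λ₁₃ P)`
(the previous theorem through the three `Iff.rfl` sockets and §0's `b8` reading). [cite: Balaban1989LargeFieldII, Thm 1 p.355, (0.1) pp.355–356, p.391; Balaban1985RegularSpaces, Thm 8 (1.146) p.101; Balaban1985UV3, Thm 1 p.257 + Thm 2 p.272; Balaban1989LargeFieldI, Prop. 1 p.194; Balaban1987RG1, Thm 3 p.264, Lemma 4 p.280; Balaban1988RG2Cluster, Lemmas 1–3 pp.9–20 (bookkeeping)] (= `N24_nodesAtSomeRecordS₁₃SepCoPH_of_pinX3HS_fourPin_pointed` at `θ := the door`; `Admissible` ← dag-n21-c `admissible_theta13OfThm1CCMW_of_le_half` (window + six signs), `SlotsNondegenerate₁₃` ← dag-n21-c `slotsNondegenerate₁₃_theta13OfThm1CCMW` (hypothesis-free), N13's (R₁₃) ← §0 `N24_laws₁₃CoPH_theta13OfThm1CCMW` (= dag-n11-e's generic `rOpLeaf_VOfRecord₁₃CoPH_theta13LiveOfNumerics`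 at the member) — ALL BY NAME; the β-box pair `hlo ∕ hhi` read at the witness's β of record `betaOfRecord₁₃ F N θ₁₅ᶜᶜᴹᵂ` (def-T `βfun_datumOfRecord₁₃SepCoPH`, `rfl`) = the currency of V16's stub 3ʷ (there at `j = 3` on the window `γ = θ₁₅ᶜᶜᴹᵂ.γ`, so the world takes `w.γ ≤ γ`); the unity guard DISCHARGED by `Stage13RParams.ZrUnity.ofHistoryBlind` over K0a FILE 17 `finsum_ζ0_ZrOfRecord₁₃`; `hP : (…).Provisos₁₃SepCoPH F N` at the door — the K0⁷ skeleton's own product — is the ONLY K0-side hypothesis left.) (= `N24_nodesAtSomeRecordS₁₃SepCoPH_of_pinX3HS_fourPin_pointed_theta13OfThm1CCMW_door` with `hP := §0`; signs `0 ≤ B₃` from the floor, `0 ≤ B₃'` from `0 ≤ b9Of·B₃ ≤ B₃'` (`b9Of_pos`); the WORLD's β-box letters `hlo ∕ hhi` (on `]0, w.γ]`, `w.γ ≤ γ`; present in the consequent ∕ rung-2 forms only) stay the closer's — the UPPER one is the K0 box's `hbox'` at `w.βup = β'` (through dag-n21-c `betaUpperH_theta13OfThm1CCMW_of_half hγh`);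 the LOWER one reads `0 < w.b` (`WorldP.b_pos`) = NODE O's positive lower bound on β, NOT supplied by the sign-free K0 box (`bₗ` may be ≤ 0).) -/
theorem N24_nodesAtSomeRecordS₁₃SepCoPH_of_pinX3HS_fourPin_pointed_theta13OfThm1CCMW_cube_of_prop8TopStep_of_prop6Member_of_betaBoxSignFree_allTorus_door {B₃ a₀ a₁ B₁ c₁ B₃' a₁' : ℝ} (hB₃ : 2 * (F.L : ℝ) ^ 2 ≤ B₃) (ha₀ : 0 < a₀)
    (h8 : Prop8RegSepTopStep F 2 (fun ν K Ω => suppDomOfRecord F ν K Ω) B₃ a₀ a₁) (hB₁ : 0 ≤ B₁) (hc₁ : 0 < c₁)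
    (hP6 : letI : CStarAlgebra (MatA 2) := {}; B8.Prop6Printed 4 (F.L : ℝ) B₁ c₁ (fun i : B8LeafModelZd.ZdIdx 4 F.L => zdCub (MatA 2) F.L i))
    (hB₉ : b9Of F (F.L ^ 3) B₁ * B₃ ≤ B₃') (ha₁' : 0 < a₁') (ha₁'le : a₁' ≤ min a₁ (a0Of F 2 (F.L ^ 3) B₁ c₁ / B₃))
    {γ ε₀ ε₂₉ : ℝ} (hγ₀ : 0 < γ) (hγh : γ ≤ 1 / 2) (hε : 0 < ε₀) (hε' : 0 < ε₂₉) {bl β' : ℝ} (hbox : BetaLowerH bl γ (betaOfRecord₁₃ F 2 (theta13OfThm1CCM F 2 3 ε₀ ε₂₉ B₃ B₃' a₀ a₁')))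
    (hbox' : BetaUpperH β' γ (betaOfRecord₁₃ F 2 (theta13OfThm1CCM F 2 3 ε₀ ε₂₉ B₃ B₃' a₀ a₁'))) (hl : -bl * γ ^ 2 ≤ 3) (hβ' : β' * γ ^ 2 ≤ 3 / 4)
    (lam8 : ResidB8 (theta13OfThm1CCMW F 2 3 γ ε₀ ε₂₉ B₃ B₃' a₀ a₁').toStage3Params)
    (lam12 : ResidB12 F 2 (theta13OfThm1CCMW F 2 3 γ ε₀ ε₂₉ B₃ B₃' a₀ a₁').τ9.M)
    (lam13 : B12.RunParams → ResidB13 (theta13OfThm1CCMW F 2 3 γ ε₀ ε₂₉ B₃ B₃' a₀ a₁').toStage3Params)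
    (Mstar : ℕ)
    (ops : OpsY 2 (theta13OfThm1CCMW F 2 3 γ ε₀ ε₂₉ B₃ B₃' a₀ a₁').toStage3Params Mstar)
    (ζ : ResidZ F 2)
    (lamW : ResidW F 2)
    (w : WorldP)
    (hC : w.C = (datumOfRecord₁₃SepCoPH F 2 (Stage13HParams.ofHistoryBlind F 2 ⟨theta13OfThm1CCMW F 2 3 γ ε₀ ε₂₉ B₃ B₃' a₀ a₁', ZrOfRecord₁₃ F 2 (theta13OfThm1CCMW F 2 3 γ ε₀ ε₂₉ B₃ B₃' a₀ a₁')⟩) (N24_provisos₁₃SepCoPH_door_theta13OfThm1CCMW_cube_of_prop8TopStep_of_prop6Member_of_betaBoxSignFree_allTorus F hB₃ ha₀ h8 hB₁ hc₁ hP6 hB₉ ha₁' ha₁'le hγ₀ hγh hε hε' hbox hbox' hl hβ')).C)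
    (hγ : 0 < w.γ ∧ w.γ ≤ (theta13OfThm1CCMW F 2 3 γ ε₀ ε₂₉ B₃ B₃' a₀ a₁').γ)
    (hL : w.L = ((theta13OfThm1CCMW F 2 3 γ ε₀ ε₂₉ B₃ B₃' a₀ a₁').L : ℝ))
    (hup : ∀ P, w.up P = upOfRecord₅CS F 2 (((Stage13HParams.ofHistoryBlind F 2 ⟨theta13OfThm1CCMW F 2 3 γ ε₀ ε₂₉ B₃ B₃' a₀ a₁', ZrOfRecord₁₃ F 2 (theta13OfThm1CCMW F 2 3 γ ε₀ ε₂₉ B₃ B₃' a₀ a₁')⟩).pinX3H F 2 lam8 lam12 lam13).view₁₃CoPHB10YZW F 2 Mstar ops ζ lamW) P)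
    (h05 : B8LeafOfRecordSubBH (theta13OfThm1CCMW F 2 3 γ ε₀ ε₂₉ B₃ B₃' a₀ a₁').toStage3Params lam8)
    (h06 : B9LeafX (Y9OfRecord 2 (theta13OfThm1CCMW F 2 3 γ ε₀ ε₂₉ B₃ B₃' a₀ a₁').toStage3Params Mstar ops))
    (h07 : B11Leaf (Z11OfRecord F 2 ζ))
    (h08 : PrintedUV3V 2 (theta13OfThm1CCMW F 2 3 γ ε₀ ε₂₉ B₃ B₃' a₀ a₁').L)
    (h09 : ∀ P : B12.RunParams, B12Sec2to5.Lemma4Printed (F12OfRecord₁₂ F 2 (theta13OfThm1CCMW F 2 3 γ ε₀ ε₂₉ B₃ B₃' a₀ a₁').toStage12Params lam12 P) (lam12 P).consts)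
    (h09T : ∀ P : B12.RunParams, (leavesP w P).smallCouplings → (leavesP w P).smallFieldInductive)
    (h10 : ∀ P : B12.RunParams, B13LeafOfRecord (theta13OfThm1CCMW F 2 3 γ ε₀ ε₂₉ B₃ B₃' a₀ a₁').toStage3Params (lam13 P))
    (h11 : ∀ P : B12.RunParams, (leavesP w P).b7 → (leavesP w P).b8 → (leavesP w P).b9 → (leavesP w P).b10 → (leavesP w P).b11 →
      (leavesP w P).smallCouplings → (leavesP w P).smallFieldInductive → (leavesP w P).flowControl →
        ∀ k, k < P.K → SLaw₁₃CoPH F 2 (Stage13HParams.ofHistoryBlind F 2 ⟨theta13OfThm1CCMW F 2 3 γ ε₀ ε₂₉ B₃ B₃' a₀ a₁', ZrOfRecord₁₃ F 2 (theta13OfThm1CCMW F 2 3 γ ε₀ ε₂₉ B₃ B₃' a₀ a₁')⟩) P k → TLaw₁₃CoPH F 2 (Stage13HParams.ofHistoryBlind F 2 ⟨theta13OfThm1CCMW F 2 3 γ ε₀ ε₂₉ B₃ B₃' a₀ a₁', ZrOfRecord₁₃ F 2 (theta13OfThm1CCMW F 2 3 γ ε₀ ε₂₉ B₃ B₃' a₀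 a₁')⟩) P k)
    (h12 : ∀ P : B12.RunParams, B15Leaf (WOfRecord₁₃ F 2 (theta13OfThm1CCMW F 2 3 γ ε₀ ε₂₉ B₃ B₃' a₀ a₁') lamW P))
    (hUV : ∀ P : B12.RunParams, (genFlow (betaOfRecord₁₃ F 2 (theta13OfThm1CCMW F 2 3 γ ε₀ ε₂₉ B₃ B₃' a₀ a₁')) P.g0).InInterval w.γ P.K → ∀ k, k ≤ P.K → SLaw₁₃CoPH F 2 (Stage13HParams.ofHistoryBlind F 2 ⟨theta13OfThm1CCMW F 2 3 γ ε₀ ε₂₉ B₃ B₃' a₀ a₁', ZrOfRecord₁₃ F 2 (theta13OfThm1CCMW F 2 3 γ ε₀ ε₂₉ B₃ B₃' a₀ a₁')⟩) P k →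
      ∀ U : GaugeField (F.P P.K) k (SU 2),
        chiβOfRecord₁₃ F 2 (theta13OfThm1CCMW F 2 3 γ ε₀ ε₂₉ B₃ B₃' a₀ a₁') P.K (gOfRecord₁₃ F 2 (theta13OfThm1CCMW F 2 3 γ ε₀ ε₂₉ B₃ B₃' a₀ a₁') P) k U *
              Real.exp (-(1 / (gOfRecord₁₃ F 2 (theta13OfThm1CCMW F 2 3 γ ε₀ ε₂₉ B₃ B₃' a₀ a₁') P k) ^ 2 * wilsonBGOfRecord F 2 (theta13OfThm1CCMW F 2 3 γ ε₀ ε₂₉ B₃ B₃' a₀ a₁').εbg P k U)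
                - w.em (gOfRecord₁₃ F 2 (theta13OfThm1CCMW F 2 3 γ ε₀ ε₂₉ B₃ B₃' a₀ a₁') P k) * (Fintype.card (Site (F.P P.K) k) : ℝ)) ≤ densOfRecord₁₃ F 2 (theta13OfThm1CCMW F 2 3 γ ε₀ ε₂₉ B₃ B₃' a₀ a₁') P k U ∧
        densOfRecord₁₃ F 2 (theta13OfThm1CCMW F 2 3 γ ε₀ ε₂₉ B₃ B₃' a₀ a₁') P k U ≤ Real.exp (w.ep (gOfRecord₁₃ F 2 (theta13OfThm1CCMW F 2 3 γ ε₀ ε₂₉ B₃ B₃' a₀ a₁') P k) * (Fintype.card (Site (F.P P.K) k) : ℝ)))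
    (hK : ∀ P : B12.RunParams, 1 ≤ P.K → lamW.kSel P < P.K) :
    ∃ (θ : Stage13HParams F 2) (hP : θ.Provisos₁₃SepCoPH F 2) (w : WorldP), (θ.ZhUnity F 2 ∧ θ.SlotsNondegenerate₁₃ F 2) ∧ θ.Admissible F 2 ∧
      (∃ (θ' : Stage13HParams F 2) (h' : θ'.Provisos₁₃SepCoPH F 2), θ'.Admissible F 2 ∧
      datumOfRecord₁₃SepCoPH F 2 θ hP = datumOfRecord₁₃SepCoPH F 2 θ' h' ∧ w.C = (datumOfRecord₁₃SepCoPH F 2 θ hP).C ∧ (0 < w.γ ∧ w.γ ≤ θ'.γ) ∧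
      w.L = (θ'.L : ℝ) ∧ ∀ P : B12.RunParams, w.up P = upOfRecord₅CS F 2 (θ'.toStage5₁₃CoPH F 2) P) ∧
      (∀ P : B12.RunParams, Nodes (leavesP w P)) ∧ PrintedUV3V 2 θ.L ∧
      ∃ lam : ResidW F 2, (∀ P : B12.RunParams, 1 ≤ P.K → lam.kSel P < P.K) ∧
        ∀ P : B12.RunParams, lam.kSel P < P.K → ((leavesP w P).rBasicStep ↔ B15Leaf (WOfRecord₁₃ F 2 θ.toStage13Params lam P)) := by
  have hL0 : (0 : ℝ) < (F.L : ℝ) := by exact_mod_cast lt_trans Nat.zero_lt_one F.hL.2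
  have hBpos : (0 : ℝ) < B₃ := lt_of_lt_of_le (mul_pos two_pos (pow_pos hL0 2)) hB₃
  have hB9 : (0 : ℝ) ≤ B₃' := (mul_nonneg (b9Of_pos (F := F) (F.L ^ 3) hB₁).le hBpos.le).trans hB₉
  exact N24_nodesAtSomeRecordS₁₃SepCoPH_of_pinX3HS_fourPin_pointed_theta13OfThm1CCMW_door (F := F) (N := 2) hγ₀ hγh hε hε' hBpos.le hB9 ha₀ ha₁' (N24_provisos₁₃SepCoPH_door_theta13OfThm1CCMW_cube_of_prop8TopStep_of_prop6Member_of_betaBoxSignFree_allTorus F hB₃ ha₀ h8 hB₁ hc₁ hP6 hB₉ ha₁' ha₁'le hγ₀ hγh hε hε' hbox hbox' hl hβ') lam8 lam12 lam13 Mstar ops ζ lamW w hC hγ hL hup h05 h06 h07 h08 h09 h09T h10 h11 h12 hUV hK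

/-- **AT THE V17 WITNESS (EVERY family `F` — no `4 ≤ F.m`), `N = 2`, `j = 3`, WITH `hP` DISCHARGED MODULO EXACTLY plan g77's announced V17 STUB BODIES — NO SIGN OF β** — [15] Prop. 8's top step `Prop8RegSepTopStep F 2 suppDom B₃ a₀ a₁` with `2L² ≤ B₃`, `0 < a₀`, `0 < a₁` (stub 1 `Prop8StepCoPAt F` opened), [6] Prop. 6 at NODE 00's member `B8.Prop6Printed 4 L B₁ c₁ (zdCub (MatA 2) L ·)` with `0 ≤ B₁`, `0 < c₁` (stub 2 `Prop6MemberB8At F` opened), the window `0 < γ ≤ ½`, the thresholds `0 < ε₀`, `0 < ε₂₉` and the SIGN-FREE windowed β-box `BetaLowerH bₗ γ ∕ BetaUpperH β' γ` with the two letters `−bₗ·γ² ≤ 3`, `β'·γ² ≤ ¾` of the β OF RECORD OF V15's WITNESS `betaOfRecord₁₃ F 2 θ₁₅ᶜᶜᴹ(3; ε₀, ε₂₉; B₃, B₃', a₀, a₁')` (= stub 3ᴬ «`−β′ ≤ β ≤ β′` on `]0, γ₀]`» after ONE window-shrinking by dag-n21-c FILE Cʷ′ `windowLettersBox_of_absBetaBox`,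 `γ := min γ₀ (min ½ (1+β′)⁻¹)`, `bₗ := −β′`; on the box it is the window edition's β, dag-n21-c `betaLowerH∕betaUpperH_theta13OfThm1CCMW_of_half`) for ANY gauge constant `B₃' ≥ b9Of·B₃` and ceiling `0 < a₁' ≤ min a₁ (a0Of∕B₃)` (V17's exact letters with `le_rfl`); door provisos BY NAME (§0) through dag-n07-e's bridge, FILE C's window-blind `gauge9R_cube_of_prop8TopStep_of_prop6Member`, B′'s `.mono ∕ .of_le`, FILE Dʷ's `hcompBoth_…_of_betaBoxSignFree_half` and Part 11's pointed §0a (FILE Eʷ ★★★ʷʰ) — AT THE V16 WITNESS SHAPE `Stage13HParams.ofHistoryBlind ⟨θ₁₅ᶜᶜᴹᵂ, ZrOfRecord₁₃ θ₁₅ᶜᶜᴹᵂ⟩` (the history-blind door over the cured residual of the windowed collared `θ₁₅ᶜᶜᴹᵂ(j; γ) = theta13OfThm1CCMW F N j γ ε₀ ε₂₉ B₃ B₃' a₀ a₁`, `0 < γ ≤ ½`; `= ofHistoryBlind (Stage13RParams.ofCured θ₁₅ᶜᶜᴹᵂ)`, `rfl`) — RUNG 2's BODY AT dag-n05-d's H-PIN**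 (`X' := XPinned₁₃H θ λ₈ λ₁₂ λ₁₃`), from the pointed children on N05's surviving route and the β-box pair.
[cite: Balaban1989LargeFieldII, Thm 1 p.355, (0.1) pp.355–356, p.391; Balaban1987RG1, Thm 3 p.264, (0.17)–(0.20) pp.255–256 and (1.22) p.264; Balaban1985RegularSpaces, Thm 8 (1.146) p.101 (bookkeeping + elementary window)] (= `N24_betaWindowAtSomeRecordS₁₃SepCoPH_of_pinX3HS_fourPin_pointed_of_boxH` at `θ := the door`; `Admissible` ← dag-n21-c `admissible_theta13OfThm1CCMW_of_le_half` (window + six signs), `SlotsNondegenerate₁₃` ← dag-n21-c `slotsNondegenerate₁₃_theta13OfThm1CCMW` (hypothesis-free), N13's (R₁₃) ← §0 `N24_laws₁₃CoPH_theta13OfThm1CCMW` (= dag-n11-e's generic `rOpLeaf_VOfRecord₁₃CoPH_theta13LiveOfNumerics` at the member) — ALL BY NAME; the β-box pair `hlo ∕ hhi` read at the witness's β of record `betaOfRecord₁₃ F N θ₁₅ᶜᶜᴹᵂ` (def-T `βfun_datumOfRecord₁₃SepCoPH`, `rfl`) = the currency of V16's stub 3ʷ (there at `j = 3` on the window `γ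 = θ₁₅ᶜᶜᴹᵂ.γ`, so the world takes `w.γ ≤ γ`); the unity guard DISCHARGED by `Stage13RParams.ZrUnity.ofHistoryBlind` over K0a FILE 17 `finsum_ζ0_ZrOfRecord₁₃`; `hP : (…).Provisos₁₃SepCoPH F N` at the door — the K0⁷ skeleton's own product — is the ONLY K0-side hypothesis left.) (= `N24_betaWindowAtSomeRecordS₁₃SepCoPH_of_pinX3HS_fourPin_pointed_of_boxH_theta13OfThm1CCMW_door` with `hP := §0`; signs `0 ≤ B₃` from the floor, `0 ≤ B₃'` from `0 ≤ b9Of·B₃ ≤ B₃'` (`b9Of_pos`); the WORLD's β-box letters `hlo ∕ hhi` (on `]0, w.γ]`, `w.γ ≤ γ`; present in the consequent ∕ rung-2 forms only) stay the closer's — the UPPER one is the K0 box's `hbox'` at `w.βup = β'` (through dag-n21-c `betaUpperH_theta13OfThm1CCMW_of_half hγh`); the LOWER one reads `0 < w.b` (`WorldP.b_pos`) = NODE O's positive lower bound on β, NOT supplied by the sign-free K0 box (`bₗ` may be ≤ 0).) -/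
theorem N24_betaWindowAtSomeRecordS₁₃SepCoPH_of_pinX3HS_fourPin_pointed_of_boxH_theta13OfThm1CCMW_cube_of_prop8TopStep_of_prop6Member_of_betaBoxSignFree_allTorus_door {B₃ a₀ a₁ B₁ c₁ B₃' a₁' : ℝ} (hB₃ : 2 * (F.L : ℝ) ^ 2 ≤ B₃) (ha₀ : 0 < a₀)
    (h8 : Prop8RegSepTopStep F 2 (fun ν K Ω => suppDomOfRecord F ν K Ω) B₃ a₀ a₁) (hB₁ : 0 ≤ B₁) (hc₁ : 0 < c₁)
    (hP6 : letI : CStarAlgebra (MatA 2) := {}; B8.Prop6Printed 4 (F.L : ℝ) B₁ c₁ (fun i : B8LeafModelZd.ZdIdx 4 F.L => zdCub (MatA 2) F.L i))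
    (hB₉ : b9Of F (F.L ^ 3) B₁ * B₃ ≤ B₃') (ha₁' : 0 < a₁') (ha₁'le : a₁' ≤ min a₁ (a0Of F 2 (F.L ^ 3) B₁ c₁ / B₃))
    {γ ε₀ ε₂₉ : ℝ} (hγ₀ : 0 < γ) (hγh : γ ≤ 1 / 2) (hε : 0 < ε₀) (hε' : 0 < ε₂₉) {bl β' : ℝ} (hbox : BetaLowerH bl γ (betaOfRecord₁₃ F 2 (theta13OfThm1CCM F 2 3 ε₀ ε₂₉ B₃ B₃' a₀ a₁')))
    (hbox' : BetaUpperH β' γ (betaOfRecord₁₃ F 2 (theta13OfThm1CCM F 2 3 ε₀ ε₂₉ B₃ B₃' a₀ a₁'))) (hl : -bl * γ ^ 2 ≤ 3) (hβ' : β' * γ ^ 2 ≤ 3 / 4)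
    (lam8 : ResidB8 (theta13OfThm1CCMW F 2 3 γ ε₀ ε₂₉ B₃ B₃' a₀ a₁').toStage3Params)
    (lam12 : ResidB12 F 2 (theta13OfThm1CCMW F 2 3 γ ε₀ ε₂₉ B₃ B₃' a₀ a₁').τ9.M)
    (lam13 : B12.RunParams → ResidB13 (theta13OfThm1CCMW F 2 3 γ ε₀ ε₂₉ B₃ B₃' a₀ a₁').toStage3Params)
    (Mstar : ℕ)
    (ops : OpsY 2 (theta13OfThm1CCMW F 2 3 γ ε₀ ε₂₉ B₃ B₃' a₀ a₁').toStage3Params Mstar)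
    (ζ : ResidZ F 2)
    (lamW : ResidW F 2)
    (w : WorldP)
    (hC : w.C = (datumOfRecord₁₃SepCoPH F 2 (Stage13HParams.ofHistoryBlind F 2 ⟨theta13OfThm1CCMW F 2 3 γ ε₀ ε₂₉ B₃ B₃' a₀ a₁', ZrOfRecord₁₃ F 2 (theta13OfThm1CCMW F 2 3 γ ε₀ ε₂₉ B₃ B₃' a₀ a₁')⟩) (N24_provisos₁₃SepCoPH_door_theta13OfThm1CCMW_cube_of_prop8TopStep_of_prop6Member_of_betaBoxSignFree_allTorus F hB₃ ha₀ h8 hB₁ hc₁ hP6 hB₉ ha₁' ha₁'le hγ₀ hγh hε hε' hbox hbox' hl hβ')).C)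
    (hγ : 0 < w.γ ∧ w.γ ≤ (theta13OfThm1CCMW F 2 3 γ ε₀ ε₂₉ B₃ B₃' a₀ a₁').γ)
    (hL : w.L = ((theta13OfThm1CCMW F 2 3 γ ε₀ ε₂₉ B₃ B₃' a₀ a₁').L : ℝ))
    (hup : ∀ P, w.up P = upOfRecord₅CS F 2 (((Stage13HParams.ofHistoryBlind F 2 ⟨theta13OfThm1CCMW F 2 3 γ ε₀ ε₂₉ B₃ B₃' a₀ a₁', ZrOfRecord₁₃ F 2 (theta13OfThm1CCMW F 2 3 γ ε₀ ε₂₉ B₃ B₃' a₀ a₁')⟩).pinX3H F 2 lam8 lam12 lam13).view₁₃CoPHB10YZW F 2 Mstar ops ζ lamW) P)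
    (h05 : B8LeafOfRecordSubBH (theta13OfThm1CCMW F 2 3 γ ε₀ ε₂₉ B₃ B₃' a₀ a₁').toStage3Params lam8)
    (h06 : B9LeafX (Y9OfRecord 2 (theta13OfThm1CCMW F 2 3 γ ε₀ ε₂₉ B₃ B₃' a₀ a₁').toStage3Params Mstar ops))
    (h07 : B11Leaf (Z11OfRecord F 2 ζ))
    (h08 : PrintedUV3V 2 (theta13OfThm1CCMW F 2 3 γ ε₀ ε₂₉ B₃ B₃' a₀ a₁').L)
    (h09 : ∀ P : B12.RunParams, B12Sec2to5.Lemma4Printed (F12OfRecord₁₂ F 2 (theta13OfThm1CCMW F 2 3 γ ε₀ ε₂₉ B₃ B₃' a₀ a₁').toStage12Params lam12 P) (lam12 P).consts)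
    (h09T : ∀ P : B12.RunParams, (leavesP w P).smallCouplings → (leavesP w P).smallFieldInductive)
    (h10 : ∀ P : B12.RunParams, B13LeafOfRecord (theta13OfThm1CCMW F 2 3 γ ε₀ ε₂₉ B₃ B₃' a₀ a₁').toStage3Params (lam13 P))
    (h11 : ∀ P : B12.RunParams, (leavesP w P).b7 → (leavesP w P).b8 → (leavesP w P).b9 → (leavesP w P).b10 → (leavesP w P).b11 →
      (leavesP w P).smallCouplings → (leavesP w P).smallFieldInductive → (leavesP w P).flowControl →
        ∀ k, k < P.K → SLaw₁₃CoPH F 2 (Stage13HParams.ofHistoryBlind F 2 ⟨theta13OfThm1CCMW F 2 3 γ ε₀ ε₂₉ B₃ B₃' a₀ a₁', ZrOfRecord₁₃ F 2 (theta13OfThm1CCMW F 2 3 γ ε₀ ε₂₉ B₃ B₃' a₀ a₁')⟩) P k → TLaw₁₃CoPH F 2 (Stage13HParams.ofHistoryBlind F 2 ⟨theta13OfThm1CCMW F 2 3 γ ε₀ ε₂₉ B₃ B₃' a₀ a₁', ZrOfRecord₁₃ F 2 (theta13OfThm1CCMW F 2 3 γ ε₀ ε₂₉ B₃ B₃' a₀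 a₁')⟩) P k)
    (h12 : ∀ P : B12.RunParams, B15Leaf (WOfRecord₁₃ F 2 (theta13OfThm1CCMW F 2 3 γ ε₀ ε₂₉ B₃ B₃' a₀ a₁') lamW P))
    (hUV : ∀ P : B12.RunParams, (genFlow (betaOfRecord₁₃ F 2 (theta13OfThm1CCMW F 2 3 γ ε₀ ε₂₉ B₃ B₃' a₀ a₁')) P.g0).InInterval w.γ P.K → ∀ k, k ≤ P.K → SLaw₁₃CoPH F 2 (Stage13HParams.ofHistoryBlind F 2 ⟨theta13OfThm1CCMW F 2 3 γ ε₀ ε₂₉ B₃ B₃' a₀ a₁', ZrOfRecord₁₃ F 2 (theta13OfThm1CCMW F 2 3 γ ε₀ ε₂₉ B₃ B₃' a₀ a₁')⟩) P k →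
      ∀ U : GaugeField (F.P P.K) k (SU 2),
        chiβOfRecord₁₃ F 2 (theta13OfThm1CCMW F 2 3 γ ε₀ ε₂₉ B₃ B₃' a₀ a₁') P.K (gOfRecord₁₃ F 2 (theta13OfThm1CCMW F 2 3 γ ε₀ ε₂₉ B₃ B₃' a₀ a₁') P) k U *
              Real.exp (-(1 / (gOfRecord₁₃ F 2 (theta13OfThm1CCMW F 2 3 γ ε₀ ε₂₉ B₃ B₃' a₀ a₁') P k) ^ 2 * wilsonBGOfRecord F 2 (theta13OfThm1CCMW F 2 3 γ ε₀ ε₂₉ B₃ B₃' a₀ a₁').εbg P k U)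
                - w.em (gOfRecord₁₃ F 2 (theta13OfThm1CCMW F 2 3 γ ε₀ ε₂₉ B₃ B₃' a₀ a₁') P k) * (Fintype.card (Site (F.P P.K) k) : ℝ)) ≤ densOfRecord₁₃ F 2 (theta13OfThm1CCMW F 2 3 γ ε₀ ε₂₉ B₃ B₃' a₀ a₁') P k U ∧
        densOfRecord₁₃ F 2 (theta13OfThm1CCMW F 2 3 γ ε₀ ε₂₉ B₃ B₃' a₀ a₁') P k U ≤ Real.exp (w.ep (gOfRecord₁₃ F 2 (theta13OfThm1CCMW F 2 3 γ ε₀ ε₂₉ B₃ B₃' a₀ a₁') P k) * (Fintype.card (Site (F.P P.K) k) : ℝ)))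
    (hlo : BetaLowerH w.b w.γ (betaOfRecord₁₃ F 2 (theta13OfThm1CCMW F 2 3 γ ε₀ ε₂₉ B₃ B₃' a₀ a₁')))
    (hhi : BetaUpperH w.βup w.γ (betaOfRecord₁₃ F 2 (theta13OfThm1CCMW F 2 3 γ ε₀ ε₂₉ B₃ B₃' a₀ a₁'))) :
    ∃ (θ : Stage13HParams F 2) (hP : θ.Provisos₁₃SepCoPH F 2) (w : WorldP), (θ.ZhUnity F 2 ∧ θ.SlotsNondegenerate₁₃ F 2) ∧ θ.Admissible F 2 ∧
      (∃ (θ' : Stage13HParams F 2) (h' : θ'.Provisos₁₃SepCoPH F 2), θ'.Admissible F 2 ∧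
      datumOfRecord₁₃SepCoPH F 2 θ hP = datumOfRecord₁₃SepCoPH F 2 θ' h' ∧ w.C = (datumOfRecord₁₃SepCoPH F 2 θ hP).C ∧ (0 < w.γ ∧ w.γ ≤ θ'.γ) ∧
      w.L = (θ'.L : ℝ) ∧ ∀ P : B12.RunParams, w.up P = upOfRecord₅CS F 2 (θ'.toStage5₁₃CoPH F 2) P) ∧
      (∀ P : B12.RunParams, Nodes (leavesP w P)) ∧ BetaBoundsInInterval w.C.toB12 w.γ w.b w.βup ∧
      ∃ γ₁ : ℝ, 0 < γ₁ ∧ ∀ γ : ℝ, 0 < γ → γ ≤ γ₁ → ∃ P : B12.RunParams, 1 ≤ P.K ∧ ((datumOfRecord₁₃SepCoPH F 2 θ hP).C P).flow.InInterval γ P.K := by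
  have hL0 : (0 : ℝ) < (F.L : ℝ) := by exact_mod_cast lt_trans Nat.zero_lt_one F.hL.2
  have hBpos : (0 : ℝ) < B₃ := lt_of_lt_of_le (mul_pos two_pos (pow_pos hL0 2)) hB₃
  have hB9 : (0 : ℝ) ≤ B₃' := (mul_nonneg (b9Of_pos (F := F) (F.L ^ 3) hB₁).le hBpos.le).trans hB₉
  exact N24_betaWindowAtSomeRecordS₁₃SepCoPH_of_pinX3HS_fourPin_pointed_of_boxH_theta13OfThm1CCMW_door (F := F) (N := 2) hγ₀ hγh hε hε' hBpos.le hB9 ha₀ ha₁' (N24_provisos₁₃SepCoPH_door_theta13OfThm1CCMW_cube_of_prop8TopStep_of_prop6Member_of_betaBoxSignFree_allTorus F hB₃ ha₀ h8 hB₁ hc₁ hP6 hB₉ ha₁' ha₁'le hγ₀ hγh hε hε' hbox hbox' hl hβ') lam8 lam12 lam13 Mstar ops ζ lamW w hC hγ hL hup h05 h06 h07 h08 h09 h09T h10 h11 h12 hUV hlo hhi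

end Summit.QuantumFields.YangMills.BalabanUVNodes.N24AtThm1CCMWDoorOfStepTokensSignFreeAllTorus

end
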